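import Literature.Probability.RandomPlanarGeometry.YangBaxterSAWColumnExchange
import HarnessLib

/-!
# Proof of Glazman–Manolescu's Proposition 4.2 (`GlazmanManolescu2019_prop42_holds`)

Topic `Literature/Probability/RandomPlanarGeometry`. This file discharges the named fact
`Literature.Probability.RandomPlanarGeometry.SAW.YangBaxter.GlazmanManolescu2019_prop42` of
`YangBaxterSAWTwoPoint.lean`: A. Glazman, I. Manolescu, *Self-avoiding walk on `ℤ²` with
Yang–Baxter weights: universality of critical fugacity and 2-point function*, Ann. Inst. Henri
Poincaré Probab. Stat. 56 (2020), arXiv:1708.00395 (`GlazmanManolescu2019`), **Proposition 4.2**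
(p. 11): "Let `Θ = {θ_k}_{k∈ℕ}` be a sequence of angles between `π/3` and `2π/3` and `T ≥ 1`. Then
for any sequence `Θ̃` obtained from `Θ` by permuting `θ₁, …, θ_T`, and for any `a, b` on the
boundary of `Strip_T`, `G_{Strip_T(Θ)}(a, b) = G_{Strip_T(Θ̃)}(a, b)`."

The proof follows the printed one (§4.2) step by step, on top of the support files
`YangBaxterSAWComplex.lean` (rhombic complexes, walks, real partition sums `Cx.wsum`, and
`twoPoint = ofReal ∘ wsum` on finite domains), `YangBaxterSAWGluing.lean` (Corollary 3.2),
`YangBaxterSAWYBIdentities.lean` and `YangBaxterSAWHexagon.lean` (Proposition 3.1 for the hexagon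
of the column exchange) and `YangBaxterSAWColumnExchange.lean` (the tilings `D_h` and the `2L+1`
Yang–Baxter moves, `G_{D_{L+1}} = G_{D_{−L}}`):

* **The ends** ("A path `γ` contributing to the above traverses `r` only as one arc … replacing the
  one arc in `r` by two arcs in the top row of `Rect_{T,L+1}(Θ)` … `G_{D_0}(a,b) − G_{Rect_{T,L}(Θ)}(a,b)
  ≤ c (G_{Rect_{T,L+1}(Θ)}(a,b) − G_{Rect_{T,L}(Θ)}(a,b))`"): `InsData`, `InsData.OrData.surgery`
  (the re-routed walk is admissible, injectivity, the weight changes by the ratio of local weights),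
  `InsData.sum_visiting_mul_le`, and the two instances `top_end` (`D_{L+1}` versus `Rect_{T,L}(Θ)`)
  and `bottom_end` (`D_{−L}` versus `Rect_{T,L}(Θ ∘ τ_i)`, after re-labelling two edges, `botCx`).
  The constant is `c = u₂(θ_{i+1} − θ_i) / (u₁(θ_i) u₂(θ_{i+1}))`, which requires `θ_i ≤ θ_{i+1}`
  ("we can also assume `θ₁ < θ₂`"; the other case follows by exchanging the roles of `Θ` and
  `Θ ∘ τ_i`, `twoPoint_strip_swap_adj`).
* **The limit** ("taking `L → ∞`"): `iSup_ofReal_le_of_coupled` — from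
  `X_L + E_L = Y_L + F_L`, `E, F ≥ 0`, `E_L ≤ c (X_{L+1} − X_L)`, `F_L ≤ c (Y_{L+1} − Y_L)` for the
  non-decreasing rectangle partition functions `X_L = G_{Rect_{T,L}(Θ)}`, `Y_L = G_{Rect_{T,L}(Θ∘τ_i)}`
  one gets `sup_L X_L = sup_L Y_L` in `[0, ∞]` (no finiteness needed), and
  `G_{Strip_T} = sup_L G_{Rect_{T,L}}` (`twoPoint_strip_eq_iSup_rect`, `YangBaxterSAWObservable.lean`).
* **Permutations** ("it suffices to prove the statement for `σ` a transposition of nearest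
  neighbours"): `twoPoint_strip_swap` (any transposition, by conjugation
  `τ_{x,y} = τ_{x+1,y} τ_{x,x+1} τ_{x+1,y}`) and `twoPoint_strip_perm` (`Equiv.Perm.swap_induction_on`
  on the finite set of columns `[0, T)`).
-/

noncomputable section

open Real

namespace Literature.Probability.RandomPlanarGeometry.SAW.YangBaxter

/-! ## The ends of the sliding: walks through the added rhombus

"A path `γ` contributing to [`G_{D_0}(a,b) − G_{Rect_{T,L}(Θ)}(a,b)`] traverses `r` only as one arc
… to any [such] `γ` associate the walk `γ'` in `Rect_{T,L+1}(Θ)` that connects `a` to `b`, obtained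
by keeping the same configuration in `Rect_{T,L}(Θ)` as in `D_0` and replacing the one arc in `r`
by two arcs in the top row of `Rect_{T,L+1}(Θ)`. Then the ratio of the weight of `γ` and `γ'` is
bounded above by some universal constant `c`. Thus
`G_{D_0}(a,b) − G_{Rect_{T,L}(Θ)}(a,b) ≤ c (G_{Rect_{T,L+1}(Θ)}(a,b) − G_{Rect_{T,L}(Θ)}(a,b))`"
(§4.2). We prove this for a complex `K` on the defect types that agrees with a grid `Θ'` on the
rectangle and whose added rhombus `r` has exactly two sides in common with the rectangle
(`InsData`), which covers the top end (`D_{L+1}`) and, after a re-labelling, the bottom end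
(`D_{−L}`). -/

section Insertion

variable {T L : ℕ}

/-- The `i`-th consecutive pair. [folklore] -/
theorem getElem_pairsOf {α : Type*} (l : List α) {i : ℕ} (hi : i < (pairsOf l).length) :
    (pairsOf l)[i] = (l[i]'(by simp [pairsOf] at hi; omega), l[i + 1]'(by simp [pairsOf] at hi; omega)) := by
  simp [pairsOf, List.getElem_zip, List.getElem_tail]

/-- In a chain of consecutive pairs of a list without repetition, a pair ending where another
starts is related to it. [folklore] -/
theorem rel_of_isChain_pairsOf {α : Type*} {R : α × α → α × α → Prop} {l : List α} (hc : (pairsOf l).IsChain R)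
    (hl : l.Nodup) {p q : α × α} (hp : p ∈ pairsOf l) (hq : q ∈ pairsOf l) (h : p.2 = q.1) : R p q := by
  obtain ⟨i, hi, rfl, rfl⟩ := pairsOf_consecutive_of_nodup hl hp hq h
  have hlen : (pairsOf l).length = l.length - 1 := by simp [pairsOf]
  have h1 := List.isChain_iff_getElem.1 hc i (by omega)
  rwa [getElem_pairsOf, getElem_pairsOf] at h1

/-- An arc of a face, read as a pair of its sides, determines the face (grid). [folklore] -/
theorem Face.eq_of_arcFace {p : MidEdge × MidEdge} {f g : Face} (h : arcFace p = some f) {s t : Side}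
    (hs : g.side s = p.1) (ht : g.side t = p.2) : g = f :=
  (gridCx_lawful fun _ => 0).eq_of_arcFace_of_sides (p := p) h hs ht

/-- **The data of an end of the sliding**: a lawful complex `K` on the defect types agreeing with
the grid `Θ'` on `Rect_{T,L}` (faces `inl`), whose added rhombus `rFace` has two sides `σ₁, σ₂`
named `inl e₁`, `inl e₂` and its two other sides named outside the grid (`inr`); and, in the grid,
an edge `mid` and two faces `g₁ ∋ e₁, mid`, `g₂ ∋ mid, e₂` of `Rect_{T,L+1} ∖ Rect_{T,L}` through
which the arc of `r` is re-routed. [cite: GlazmanManolescu2019, §4.2 ("replacing the one arc in r by two arcs in the top row of Rect_{T,L+1}")] -/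
structure InsData (K : Cx DFace DEdge) (Θ' : ℤ → ℝ) (T L : ℕ) where
  /-- the two grid edges of `r` -/
  e₁ : MidEdge
  /-- the two grid edges of `r` -/
  e₂ : MidEdge
  /-- the inserted edge -/
  mid : MidEdge
  /-- the sides of `r` carrying `e₁, e₂` -/
  σ₁ : Side
  /-- the sides of `r` carrying `e₁, e₂` -/
  σ₂ : Side
  /-- the two grid faces of the re-routing -/
  g₁ : Face
  /-- the two grid faces of the re-routing -/
  g₂ : Face
  /-- `e₁ = g₁.side τ₁`, `mid = g₁.side μ₁ = g₂.side μ₂`, `e₂ = g₂.side τ₂` -/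
  τ₁ : Side
  /-- see `τ₁` -/
  μ₁ : Side
  /-- see `τ₁` -/
  μ₂ : Side
  /-- see `τ₁` -/
  τ₂ : Side
  hσ : σ₁ ≠ σ₂
  side_r₁ : K.side rFace σ₁ = .inl e₁
  side_r₂ : K.side rFace σ₂ = .inl e₂
  other_inr : ∀ σ, σ ≠ σ₁ → σ ≠ σ₂ → ∃ y, K.side rFace σ = .inr y
  hag : ∀ f ∈ rect T L, ∀ s, K.side (.inl f) s = .inl (f.side s)
  hang : ∀ f ∈ rect T L, K.angle (.inl f) = Θ' f.1
  hg₁e : g₁.side τ₁ = e₁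
  hg₁m : g₁.side μ₁ = mid
  hg₂m : g₂.side μ₂ = mid
  hg₂e : g₂.side τ₂ = e₂
  hτμ₁ : τ₁ ≠ μ₁
  hτμ₂ : μ₂ ≠ τ₂
  hg₁₂ : g₁ ≠ g₂
  hg₁ : g₁ ∈ rect T (L + 1)
  hg₂ : g₂ ∈ rect T (L + 1)
  hg₁' : g₁ ∉ rect T L
  hg₂' : g₂ ∉ rect T L
  hmid : ∀ f ∈ rect T L, ∀ s, f.side s ≠ mid
  hmid₁ : mid ≠ e₁
  hmid₂ : mid ≠ e₂

namespace InsData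

variable {K : Cx DFace DEdge} {Θ' : ℤ → ℝ} (I : InsData K Θ' T L)

/-- The embedding of the grid rectangle into `K`. [folklore] -/
def emb : Cx.Emb (gridCx Θ') K (rect T L) where
  φF := Sum.inl
  φE := Sum.inl
  injE := Sum.inl_injective
  injF := Set.injOn_of_injective Sum.inl_injective
  side_eq := I.hag
  angle_eq := I.hang

/-- The domain of `K` is the image of the rectangle plus `r`. [folklore] -/
theorem defDom_eq : defDom T L = I.emb.φF '' rect T L ∪ {rFace} := rfl

variable (hK : K.Lawful)
include I hK

omit hK in
/-- The sides of `r` that are grid edges are `e₁, e₂`. [folklore] -/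
theorem side_r_eq_inl {σ : Side} {e : MidEdge} (h : K.side rFace σ = .inl e) :
    (σ = I.σ₁ ∧ e = I.e₁) ∨ (σ = I.σ₂ ∧ e = I.e₂) := by
  by_cases h1 : σ = I.σ₁
  · subst h1; rw [I.side_r₁] at h; exact Or.inl ⟨rfl, (Sum.inl_injective h).symm⟩
  · by_cases h2 : σ = I.σ₂
    · subst h2; rw [I.side_r₂] at h; exact Or.inr ⟨rfl, (Sum.inl_injective h).symm⟩
    · obtain ⟨y, hy⟩ := I.other_inr σ h1 h2
      rw [hy] at h; cases h

/-- **An arc of `K` drawn in `r` joins `e₁` and `e₂`.** [cite: GlazmanManolescu2019, §4.2 ("traverses r only as one arc")] -/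
theorem arc_in_r {p : MidEdge × MidEdge} (h : K.arcFace (Prod.map Sum.inl Sum.inl p) = some rFace) :
    p = (I.e₁, I.e₂) ∨ p = (I.e₂, I.e₁) := by
  obtain ⟨hne, ⟨s, hs⟩, ⟨t, ht⟩⟩ := (hK.commonFace_eq_some_iff _ _ _).1 h
  simp only [Prod.map_fst, Prod.map_snd] at hne hs ht
  obtain ⟨p1, p2⟩ := p
  simp only at hs ht
  rcases I.side_r_eq_inl hs with ⟨-, rfl⟩ | ⟨-, rfl⟩ <;> rcases I.side_r_eq_inl ht with ⟨-, rfl⟩ | ⟨-, rfl⟩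
  · exact absurd rfl hne
  · exact Or.inl rfl
  · exact Or.inr rfl
  · exact absurd rfl hne

/-- **A walk of `K` between grid edges only crosses grid edges.** [cite: GlazmanManolescu2019, §4.2] -/
theorem mem_walk_isLeft {a b : MidEdge} {m : List DEdge} (hm : K.IsWalk (defDom T L) (.inl a) (.inl b) m)
    {e : DEdge} (he : e ∈ m) : ∃ e₀, e = .inl e₀ := by
  rcases e with e₀ | y
  · exact ⟨e₀, rfl⟩
  · exfalso
    -- `inr y` is a side of `r` only, hence crossed between two arcs both in `r`
    obtain ⟨k, hk, hky⟩ := List.getElem_of_mem he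
    have hfaces : ∀ (F : DFace), F ∈ defDom T L → ∀ s, K.side F s = Sum.inr y → F = rFace := by
      intro F hF s hs
      rcases hF with ⟨f, hf, rfl⟩ | hF
      · rw [I.hag f hf] at hs; cases hs
      · exact hF
    rcases Nat.eq_zero_or_pos k with rfl | hk0
    · have := hm.head_eq
      rw [List.head?_eq_getElem?, List.getElem?_eq_getElem hk, hky] at this
      cases this
    · by_cases hkl : k + 1 < m.length
      · -- interior: two arcs at `inr y`
        obtain ⟨j, rfl⟩ : ∃ j, k = j + 1 := ⟨k - 1, by omega⟩
        have hp : (m[j], m[j + 1]) ∈ pairsOf m := mem_pairsOf_iff.2 ⟨j, hk, rfl⟩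
        have hq : (m[j + 1], m[j + 1 + 1]) ∈ pairsOf m := mem_pairsOf_iff.2 ⟨j + 1, hkl, rfl⟩
        obtain ⟨F, hF, hpF⟩ := hm.arc_mem _ hp
        obtain ⟨G, hG, hqG⟩ := hm.arc_mem _ hq
        obtain ⟨-, -, ⟨t, ht⟩⟩ := (hK.commonFace_eq_some_iff _ _ F).1 hpF
        obtain ⟨-, ⟨s, hs⟩, -⟩ := (hK.commonFace_eq_some_iff _ _ G).1 hqG
        simp only [hky] at ht hs
        have hF' := hfaces F hF t ht
        have hG' := hfaces G hG s hs
        subst hF'; subst hG'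
        have := rel_of_isChain_pairsOf hm.isChain hm.nodup hp hq rfl
        rw [hpF, hqG] at this
        exact this rfl
      · have hlast := hm.getLast_eq
        rw [List.getLast?_eq_getElem?, show m.length - 1 = k by omega, List.getElem?_eq_getElem hk, hky] at hlast
        cases hlast

/-- A walk of `K` between grid edges is the image of a grid edge list. [folklore] -/
theorem exists_eq_map {a b : MidEdge} {m : List DEdge} (hm : K.IsWalk (defDom T L) (.inl a) (.inl b) m) :
    ∃ m₀ : List MidEdge, m = m₀.map Sum.inl := by
  induction m with
  | nil => exact ⟨[], rfl⟩
  | cons e m ih =>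
    -- direct construction by `filterMap`
    refine ⟨(e :: m).filterMap Sum.getLeft?, ?_⟩
    clear ih
    have : ∀ x ∈ e :: m, ∃ x₀, x = Sum.inl x₀ := fun x hx => I.mem_walk_isLeft hK hm hx
    generalize e :: m = l at this
    induction l with
    | nil => rfl
    | cons x l ih' =>
      obtain ⟨x₀, rfl⟩ := this x (by simp)
      rw [List.filterMap_cons]
      simp only [Sum.getLeft?_inl, List.map_cons, List.cons.injEq, true_and]
      exact ih' fun y hy => this y (by simp [hy])

omit I hK in
/-- The arcs of the image of a grid edge list. [folklore] -/
theorem pairsOf_map_inl (m₀ : List MidEdge) :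
    pairsOf (m₀.map (Sum.inl : MidEdge → DEdge)) = (pairsOf m₀).map (Prod.map Sum.inl Sum.inl) := pairsOf_map _ _

/-- **A walk of `K` visiting `r` splits at its unique arc in `r`**: it is
`(u ++ [x, y] ++ v).map inl` with `{x, y} = {e₁, e₂}`. [cite: GlazmanManolescu2019, §4.2] -/
theorem exists_split {a b : MidEdge} {m : List DEdge}
    (hm : K.IsWalk (defDom T L) (.inl a) (.inl b) m) (hr : rFace ∈ K.facesOf m) :
    ∃ (u v : List MidEdge) (x y : MidEdge), ((x, y) = (I.e₁, I.e₂) ∨ (x, y) = (I.e₂, I.e₁)) ∧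
      m = (u ++ x :: y :: v).map Sum.inl := by
  obtain ⟨m₀, rfl⟩ := I.exists_eq_map hK hm
  obtain ⟨p, hp, hpr⟩ := List.mem_filterMap.1 (List.mem_toFinset.1 hr)
  rw [pairsOf_map_inl, List.mem_map] at hp
  obtain ⟨q, hq, rfl⟩ := hp
  have hq' := I.arc_in_r hK hpr
  obtain ⟨k, hk, rfl⟩ := mem_pairsOf_iff.1 hq
  refine ⟨m₀.take k, m₀.drop (k + 2), m₀[k], m₀[k + 1], hq', ?_⟩
  have h1 : m₀ = m₀.take k ++ m₀.drop k := (List.take_append_drop k m₀).symm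
  rw [List.drop_eq_getElem_cons (show k < m₀.length by omega), List.drop_eq_getElem_cons hk] at h1
  exact congrArg _ h1

end InsData

end Insertion

section Surgery

variable {T L : ℕ} {K : Cx DFace DEdge} {Θ' : ℤ → ℝ}

/-- Rectangles increase with their height. [cite: GlazmanManolescu2019, §2.1] -/
theorem rect_mono_succ {T L : ℕ} {f : Face} (hf : f ∈ rect T L) : f ∈ rect T (L + 1) :=
  ⟨hf.1, hf.2.1, by have := hf.2.2.1; push_cast; omega, by have := hf.2.2.2; push_cast; omega⟩

namespace InsData

/-- **The oriented data of a re-routing**: the arc of `r` is traversed from `x` to `y`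
(`{x, y} = {e₁, e₂}`), first through the grid face `gA ∋ x, mid`, then through `gB ∋ mid, y`.
[cite: GlazmanManolescu2019, §4.2] -/
structure OrData (I : InsData K Θ' T L) where
  /-- the arc of `r`, oriented -/
  x : MidEdge
  /-- the arc of `r`, oriented -/
  y : MidEdge
  /-- the first grid face of the re-routing -/
  gA : Face
  /-- the second grid face of the re-routing -/
  gB : Face
  /-- `x = gA.side τA` -/
  τA : Side
  /-- `mid = gA.side μA` -/
  μA : Side
  /-- `mid = gB.side μB` -/
  μB : Side
  /-- `y = gB.side τB` -/
  τB : Side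
  /-- the side of `r` carrying `x` -/
  σx : Side
  /-- the side of `r` carrying `y` -/
  σy : Side
  hσ : σx ≠ σy
  side_rx : K.side rFace σx = .inl x
  side_ry : K.side rFace σy = .inl y
  other_inr : ∀ σ, σ ≠ σx → σ ≠ σy → ∃ z, K.side rFace σ = .inr z
  hgAx : gA.side τA = x
  hgAm : gA.side μA = I.mid
  hgBm : gB.side μB = I.mid
  hgBy : gB.side τB = y
  hτμA : τA ≠ μA
  hτμB : μB ≠ τB
  hgAB : gA ≠ gB
  hgA : gA ∈ rect T (L + 1)
  hgB : gB ∈ rect T (L + 1)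
  hgA' : gA ∉ rect T L
  hgB' : gB ∉ rect T L
  hmidx : I.mid ≠ x
  hmidy : I.mid ≠ y

variable (I : InsData K Θ' T L)

/-- The orientation `e₁ → e₂`. [cite: GlazmanManolescu2019, §4.2] -/
def or₁ : I.OrData where
  x := I.e₁
  y := I.e₂
  gA := I.g₁
  gB := I.g₂
  τA := I.τ₁
  μA := I.μ₁
  μB := I.μ₂
  τB := I.τ₂
  σx := I.σ₁
  σy := I.σ₂
  hσ := I.hσ
  side_rx := I.side_r₁
  side_ry := I.side_r₂
  other_inr := I.other_inr
  hgAx := I.hg₁e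
  hgAm := I.hg₁m
  hgBm := I.hg₂m
  hgBy := I.hg₂e
  hτμA := I.hτμ₁
  hτμB := I.hτμ₂
  hgAB := I.hg₁₂
  hgA := I.hg₁
  hgB := I.hg₂
  hgA' := I.hg₁'
  hgB' := I.hg₂'
  hmidx := I.hmid₁
  hmidy := I.hmid₂

/-- The orientation `e₂ → e₁`. [cite: GlazmanManolescu2019, §4.2] -/
def or₂ : I.OrData where
  x := I.e₂
  y := I.e₁
  gA := I.g₂
  gB := I.g₁
  τA := I.τ₂
  μA := I.μ₂
  μB := I.μ₁
  τB := I.τ₁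
  σx := I.σ₂
  σy := I.σ₁
  hσ := I.hσ.symm
  side_rx := I.side_r₂
  side_ry := I.side_r₁
  other_inr σ h1 h2 := I.other_inr σ h2 h1
  hgAx := I.hg₂e
  hgAm := I.hg₂m
  hgBm := I.hg₁m
  hgBy := I.hg₁e
  hτμA := I.hτμ₂.symm
  hτμB := I.hτμ₁.symm
  hgAB := I.hg₁₂.symm
  hgA := I.hg₂
  hgB := I.hg₁
  hgA' := I.hg₂'
  hgB' := I.hg₁'
  hmidx := I.hmid₂
  hmidy := I.hmid₁

variable {I} (hK : K.Lawful) (O : I.OrData)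
include hK

omit hK in
/-- The sides of `r` that are grid edges, oriented form. [folklore] -/
theorem OrData.side_r_eq_inl {σ : Side} {e : MidEdge} (h : K.side rFace σ = .inl e) :
    (σ = O.σx ∧ e = O.x) ∨ (σ = O.σy ∧ e = O.y) := by
  by_cases h1 : σ = O.σx
  · subst h1; rw [O.side_rx] at h; exact Or.inl ⟨rfl, (Sum.inl_injective h).symm⟩
  · by_cases h2 : σ = O.σy
    · subst h2; rw [O.side_ry] at h; exact Or.inr ⟨rfl, (Sum.inl_injective h).symm⟩
    · obtain ⟨z, hz⟩ := O.other_inr σ h1 h2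
      rw [hz] at h; cases h

/-- **The re-routing of a walk through the added rhombus** ("replacing the one arc in `r` by two
arcs in the top row of `Rect_{T,L+1}(Θ)`"): validity, the new face is visited, and the weights
differ by the ratio of the local weights. [cite: GlazmanManolescu2019, §4.2] -/
theorem OrData.surgery {a b : MidEdge} (ha : a ≠ I.mid) {u v : List MidEdge}
    (hm : K.IsWalk (defDom T L) (.inl a) (.inl b) ((u ++ O.x :: O.y :: v).map Sum.inl)) :
    (gridCx Θ').IsWalk (rect T (L + 1)) a b (u ++ O.x :: I.mid :: O.y :: v) ∧
    O.gA ∈ (gridCx Θ').facesOf (u ++ O.x :: I.mid :: O.y :: v) ∧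
    K.weight ((u ++ O.x :: O.y :: v).map Sum.inl) *
        (localWeight (Θ' O.gA.1) [arcKind O.τA O.μA] * localWeight (Θ' O.gB.1) [arcKind O.μB O.τB]) =
      (gridCx Θ').weight (u ++ O.x :: I.mid :: O.y :: v) * localWeight (K.angle rFace) [arcKind O.σx O.σy] := by
  classical
  -- notation
  set P : List MidEdge := u ++ [O.x] with hP
  set Q : List MidEdge := O.y :: v with hQ
  set m₀ : List MidEdge := u ++ O.x :: O.y :: v with hm₀
  set m₀' : List MidEdge := u ++ O.x :: I.mid :: O.y :: v with hm₀'
  set im : MidEdge × MidEdge → DEdge × DEdge := Prod.map Sum.inl Sum.inl with him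
  have hGl : (gridCx Θ').Lawful := gridCx_lawful Θ'
  have hPne : P ≠ [] := by simp [hP]
  have hQne : Q ≠ [] := List.cons_ne_nil _ _
  have hm₀PQ : m₀ = P ++ Q := by simp [hm₀, hP, hQ]
  have hm₀'PQ : m₀' = P ++ I.mid :: Q := by simp [hm₀', hP, hQ]
  have hPlast : P.getLast hPne = O.x := by simp [hP]
  have hpm₀ : pairsOf m₀ = pairsOf P ++ (O.x, O.y) :: pairsOf Q := by
    rw [hm₀PQ, pairsOf_append hPne hQne, hPlast]; rfl
  have hpm₀' : pairsOf m₀' = pairsOf P ++ (O.x, I.mid) :: (I.mid, O.y) :: pairsOf Q := by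
    rw [hm₀'PQ, pairsOf_append hPne (List.cons_ne_nil _ _), hPlast]; rfl
  have hpm : pairsOf (m₀.map Sum.inl) = (pairsOf m₀).map im := pairsOf_map _ _
  -- facts from the walk
  have hnd : m₀.Nodup := hm.nodup.of_map _
  have hndPQ : P.Nodup ∧ Q.Nodup ∧ ∀ e ∈ P, ∀ e' ∈ Q, e ≠ e' := by rw [hm₀PQ] at hnd; exact List.nodup_append.1 hnd
  have hxy_mem : (O.x, O.y) ∈ pairsOf m₀ := by rw [hpm₀]; simp
  have hyx_not : (O.y, O.x) ∉ pairsOf m₀ := by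
    intro h
    obtain ⟨i, hi, h1, h2⟩ := pairsOf_consecutive_of_nodup hnd hxy_mem h rfl
    have := (List.Nodup.getElem_inj_iff hnd).1 ((Prod.mk.inj h1).1.symm.trans (Prod.mk.inj h2).2)
    omega
  -- `{e₁, e₂} = {x, y}`
  have hexy : (I.e₁ = O.x ∧ I.e₂ = O.y) ∨ (I.e₁ = O.y ∧ I.e₂ = O.x) := by
    rcases O.side_r_eq_inl I.side_r₁ with ⟨h1, h2⟩ | ⟨h1, h2⟩ <;>
      rcases O.side_r_eq_inl I.side_r₂ with ⟨h3, h4⟩ | ⟨h3, h4⟩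
    · exact absurd (h1.trans h3.symm) I.hσ
    · exact Or.inl ⟨h2, h4⟩
    · exact Or.inr ⟨h2, h4⟩
    · exact absurd (h1.trans h3.symm) I.hσ
  -- the outer arcs are grid arcs of the rectangle
  have harc : ∀ p ∈ pairsOf m₀, p ≠ (O.x, O.y) →
      ∃ f ∈ rect T L, K.arcFace (im p) = some (.inl f) ∧ (gridCx Θ').arcFace p = some f := by
    intro p hp hpxy
    obtain ⟨F, hF, hpF⟩ := hm.arc_mem (im p) (by rw [hpm]; exact List.mem_map_of_mem hp)
    rcases hF with ⟨f, hf, rfl⟩ | hF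
    · exact ⟨f, hf, hpF, (I.emb.arcFace_map_eq_some_iff hGl hK p hf).1 hpF⟩
    · rw [Set.mem_singleton_iff] at hF
      subst hF
      exfalso
      rcases I.arc_in_r hK hpF with h | h <;> rcases hexy with ⟨h1, h2⟩ | ⟨h1, h2⟩ <;> rw [h, h1, h2] at hpxy hp
      · exact hpxy rfl
      · exact hyx_not hp
      · exact hyx_not hp
      · exact hpxy rfl
  have hPQsub : ∀ p, p ∈ pairsOf P ∨ p ∈ pairsOf Q → p ∈ pairsOf m₀ ∧ p ≠ (O.x, O.y) := by
    intro p hp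
    refine ⟨by rw [hpm₀]; rcases hp with hp | hp <;> simp [hp], fun hpxy => ?_⟩
    subst hpxy
    rcases hp with hp | hp
    · exact hndPQ.2.2 O.y (mem_of_mem_pairsOf hp).2 O.y (by simp [hQ]) rfl
    · exact hndPQ.2.2 O.x (by simp [hP]) O.x (mem_of_mem_pairsOf hp).1 rfl
  have harcP : ∀ p ∈ pairsOf P, ∃ f ∈ rect T L, K.arcFace (im p) = some (.inl f) ∧ (gridCx Θ').arcFace p = some f :=
    fun p hp => let h := hPQsub p (Or.inl hp); harc p h.1 h.2
  have harcQ : ∀ p ∈ pairsOf Q, ∃ f ∈ rect T L, K.arcFace (im p) = some (.inl f) ∧ (gridCx Θ').arcFace p = some f :=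
    fun p hp => let h := hPQsub p (Or.inr hp); harc p h.1 h.2
  have harcPQ : ∀ p ∈ pairsOf P ++ pairsOf Q, ∃ f ∈ rect T L, K.arcFace (im p) = some (.inl f) ∧ (gridCx Θ').arcFace p = some f := by
    intro p hp
    rcases List.mem_append.1 hp with hp | hp
    exacts [harcP p hp, harcQ p hp]
  -- the two new arcs
  have hA : (gridCx Θ').arcFace (O.x, I.mid) = some O.gA := by
    have := hGl.arcFace_side_side O.gA O.hτμA
    rwa [show (gridCx Θ').side O.gA O.τA = O.x from O.hgAx, show (gridCx Θ').side O.gA O.μA = I.mid from O.hgAm] at this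
  have hB : (gridCx Θ').arcFace (I.mid, O.y) = some O.gB := by
    have := hGl.arcFace_side_side O.gB O.hτμB
    rwa [show (gridCx Θ').side O.gB O.μB = I.mid from O.hgBm, show (gridCx Θ').side O.gB O.τB = O.y from O.hgBy] at this
  have hmid_not : I.mid ∉ m₀ := by
    intro hmem
    rcases hm.mem_cases hK (List.mem_map_of_mem (f := Sum.inl) hmem) with h | ⟨F, hF, s, hs⟩
    · exact ha (Sum.inl_injective h).symm
    · rcases hF with ⟨f, hf, rfl⟩ | hF
      · rw [I.hag f hf] at hs; exact I.hmid f hf s (Sum.inl_injective hs)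
      · rw [Set.mem_singleton_iff] at hF; subst hF
        rcases O.side_r_eq_inl hs with ⟨-, h⟩ | ⟨-, h⟩
        · exact O.hmidx h
        · exact O.hmidy h
  -- membership of the new list's pairs
  have hmem' : ∀ p, p ∈ pairsOf m₀' ↔ p ∈ pairsOf P ∨ p = (O.x, I.mid) ∨ p = (I.mid, O.y) ∨ p ∈ pairsOf Q := by
    intro p; rw [hpm₀']; simp only [List.mem_append, List.mem_cons]
  -- side pairs of the faces
  have face_of_P : ∀ (f : Face) (s t : Side), (f.side s, f.side t) ∈ pairsOf P ∨ (f.side s, f.side t) ∈ pairsOf Q → f ∈ rect T L := by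
    intro f s t hp
    obtain ⟨hp1, hp2⟩ := hPQsub _ hp
    obtain ⟨f', hf', -, hpf'⟩ := harc _ hp1 hp2
    rwa [Face.eq_of_arcFace hpf' (g := f) rfl rfl]
  have sidesA : ∀ s t, (O.gA.side s, O.gA.side t) ∈ pairsOf m₀' → s = O.τA ∧ t = O.μA := by
    intro s t h
    rcases (hmem' _).1 h with h | h | h | h
    · exact absurd (face_of_P _ _ _ (Or.inl h)) O.hgA'
    · obtain ⟨h1, h2⟩ := Prod.mk.inj h
      exact ⟨Face.side_injective _ (h1.trans O.hgAx.symm), Face.side_injective _ (h2.trans O.hgAm.symm)⟩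
    · obtain ⟨h1, h2⟩ := Prod.mk.inj h
      exact absurd (Face.eq_of_arcFace hB (g := O.gA) h1 h2) O.hgAB
    · exact absurd (face_of_P _ _ _ (Or.inr h)) O.hgA'
  have sidesB : ∀ s t, (O.gB.side s, O.gB.side t) ∈ pairsOf m₀' → s = O.μB ∧ t = O.τB := by
    intro s t h
    rcases (hmem' _).1 h with h | h | h | h
    · exact absurd (face_of_P _ _ _ (Or.inl h)) O.hgB'
    · obtain ⟨h1, h2⟩ := Prod.mk.inj h
      exact absurd (Face.eq_of_arcFace hA (g := O.gB) h1 h2) O.hgAB.symm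
    · obtain ⟨h1, h2⟩ := Prod.mk.inj h
      exact ⟨Face.side_injective _ (h1.trans O.hgBm.symm), Face.side_injective _ (h2.trans O.hgBy.symm)⟩
    · exact absurd (face_of_P _ _ _ (Or.inr h)) O.hgB'
  have transfer : ∀ (f : Face) (s t : Side), f ≠ O.gA → f ≠ O.gB → (f.side s, f.side t) ∈ pairsOf m₀' →
      f ∈ rect T L ∧ (K.side (.inl f) s, K.side (.inl f) t) ∈ pairsOf (m₀.map Sum.inl) := by
    intro f s t hfA hfB h
    have h' : (f.side s, f.side t) ∈ pairsOf P ∨ (f.side s, f.side t) ∈ pairsOf Q := by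
      rcases (hmem' _).1 h with h | h | h | h
      · exact Or.inl h
      · obtain ⟨h1, h2⟩ := Prod.mk.inj h
        exact absurd (Face.eq_of_arcFace hA (g := f) h1 h2) hfA
      · obtain ⟨h1, h2⟩ := Prod.mk.inj h
        exact absurd (Face.eq_of_arcFace hB (g := f) h1 h2) hfB
      · exact Or.inr h
    have hf := face_of_P f s t h'
    refine ⟨hf, ?_⟩
    rw [I.hag f hf, I.hag f hf, hpm]
    exact List.mem_map_of_mem (f := im) (hPQsub _ h').1
  -- (1) validity of the new grid walk
  have hvalid : (gridCx Θ').IsWalk (rect T (L + 1)) a b m₀' := by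
    refine ⟨?_, ?_, ?_, ?_, ?_, ?_⟩
    · have h1 := hm.head_eq
      rw [List.head?_map, hm₀PQ, List.head?_append_of_ne_nil _ hPne] at h1
      rw [hm₀'PQ, List.head?_append_of_ne_nil _ hPne]
      rcases hP' : P.head? with _ | e
      · rw [hP'] at h1; cases h1
      · rw [hP'] at h1; simp only [Option.map_some, Option.some.injEq] at h1; rw [Sum.inl_injective h1]
    · have h1 := hm.getLast_eq
      rw [List.getLast?_map, hm₀PQ, List.getLast?_append_of_ne_nil _ hQne] at h1
      rw [hm₀'PQ, List.getLast?_append_of_ne_nil _ (List.cons_ne_nil _ _), List.getLast?_cons_cons]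
      rcases hQ' : Q.getLast? with _ | e
      · rw [hQ'] at h1; cases h1
      · rw [hQ'] at h1; simp only [Option.map_some, Option.some.injEq] at h1; rw [Sum.inl_injective h1]
    · rw [hm₀'PQ, List.nodup_middle, List.nodup_cons, ← hm₀PQ]
      exact ⟨hmid_not, hnd⟩
    · intro p hp
      rcases (hmem' p).1 hp with h | rfl | rfl | h
      · obtain ⟨f, hf, -, hpf⟩ := harcP p h; exact ⟨f, rect_mono_succ hf, hpf⟩
      · exact ⟨_, O.hgA, hA⟩
      · exact ⟨_, O.hgB, hB⟩
      · obtain ⟨f, hf, -, hpf⟩ := harcQ p h; exact ⟨f, rect_mono_succ hf, hpf⟩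
    · -- the chain condition
      have hc := hm.isChain
      rw [hpm, hpm₀, List.map_append, List.map_cons, List.isChain_append] at hc
      obtain ⟨hcP, hcQ, -⟩ := hc
      have hcQ' : ((pairsOf Q).map im).IsChain fun p q => K.arcFace p ≠ K.arcFace q := by
        cases hQ' : (pairsOf Q).map im with
        | nil => exact .nil
        | cons q l => rw [hQ'] at hcQ; exact (List.isChain_cons_cons.1 hcQ).2
      have toG : ∀ l : List (MidEdge × MidEdge),
          (∀ p ∈ l, ∃ f ∈ rect T L, K.arcFace (im p) = some (.inl f) ∧ (gridCx Θ').arcFace p = some f) →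
          (l.map im).IsChain (fun p q => K.arcFace p ≠ K.arcFace q) →
            l.IsChain fun p q => (gridCx Θ').arcFace p ≠ (gridCx Θ').arcFace q := by
        intro l hl hcl
        rw [List.isChain_map] at hcl
        have := Cx.isChain_map_of_mem (S := fun p q => (gridCx Θ').arcFace p ≠ (gridCx Θ').arcFace q) id hcl
          fun p hp q hq hpq heq => hpq (by
            obtain ⟨f, -, hKf, hGf⟩ := hl p hp
            obtain ⟨g, -, hKg, hGg⟩ := hl q hq
            simp only [id] at heq
            rw [hGf, hGg] at heq
            rw [hKf, hKg, Option.some_injective _ heq])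
        simpa using this
      rw [hpm₀', List.isChain_append]
      refine ⟨toG _ harcP hcP, ?_, ?_⟩
      · rw [List.isChain_cons_cons]
        refine ⟨by rw [hA, hB]; exact fun h => O.hgAB (Option.some_injective _ h), ?_⟩
        rw [show (I.mid, O.y) :: pairsOf Q = [(I.mid, O.y)] ++ pairsOf Q from rfl, List.isChain_append]
        refine ⟨List.isChain_singleton _, toG _ harcQ hcQ', fun p hp q hq => ?_⟩
        simp only [List.getLast?_singleton, Option.mem_def, Option.some.injEq] at hp
        subst hp
        obtain ⟨f, hf, -, hqf⟩ := harcQ q (List.mem_of_head? hq)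
        rw [hB, hqf]
        exact fun h => O.hgB' (Option.some_injective _ h ▸ hf)
      · intro p hp q hq
        simp only [List.head?_cons, Option.mem_def, Option.some.injEq] at hq
        subst hq
        obtain ⟨f, hf, -, hpf⟩ := harcP p (List.mem_of_getLast? hp)
        rw [hA, hpf]
        exact fun h => O.hgA' (Option.some_injective _ h ▸ hf)
    · -- no crossing
      intro f hWE
      change ((f.side .W, f.side .E) ∈ pairsOf m₀' ∨ (f.side .E, f.side .W) ∈ pairsOf m₀') at hWE
      change ¬((f.side .S, f.side .N) ∈ pairsOf m₀' ∨ (f.side .N, f.side .S) ∈ pairsOf m₀')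
      intro hSN
      by_cases hfA : f = O.gA
      · subst hfA
        rcases hWE with h | h <;> rcases hSN with h' | h' <;>
          (obtain ⟨h1, -⟩ := sidesA _ _ h; obtain ⟨h2, -⟩ := sidesA _ _ h'; rw [← h2] at h1; cases h1)
      · by_cases hfB : f = O.gB
        · subst hfB
          rcases hWE with h | h <;> rcases hSN with h' | h' <;>
            (obtain ⟨h1, -⟩ := sidesB _ _ h; obtain ⟨h2, -⟩ := sidesB _ _ h'; rw [← h2] at h1; cases h1)
        · have tr : ∀ s t, (f.side s, f.side t) ∈ pairsOf m₀' → (K.side (.inl f) s, K.side (.inl f) t) ∈ pairsOf (m₀.map Sum.inl) :=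
            fun s t h => (transfer f s t hfA hfB h).2
          exact hm.noncross (.inl f) (hWE.imp (tr _ _) (tr _ _)) (hSN.imp (tr _ _) (tr _ _))
  refine ⟨hvalid, List.mem_toFinset.2 (List.mem_filterMap.2 ⟨(O.x, I.mid), (hmem' _).2 (Or.inr (Or.inl rfl)), hA⟩), ?_⟩
  -- (3) the weights
  set Fo : Finset Face := ((pairsOf P ++ pairsOf Q).filterMap (gridCx Θ').arcFace).toFinset with hFo
  have hFo_sub : ∀ f ∈ Fo, f ∈ rect T L := by
    intro f hf
    obtain ⟨p, hp, hpf⟩ := List.mem_filterMap.1 (List.mem_toFinset.1 hf)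
    obtain ⟨f', hf', -, hpf'⟩ := harcPQ p hp
    rw [hpf'] at hpf
    cases hpf
    exact hf'
  have hxyK : K.arcFace (im (O.x, O.y)) = some rFace :=
    (hK.commonFace_eq_some_iff _ _ _).2
      ⟨fun h => hndPQ.2.2 O.x (by simp [hP]) O.y (by simp [hQ]) (Sum.inl_injective h), ⟨O.σx, O.side_rx⟩, ⟨O.σy, O.side_ry⟩⟩
  have hfacesK : K.facesOf (m₀.map Sum.inl) = insert rFace (Fo.image Sum.inl) := by
    ext F
    simp only [Cx.facesOf, hpm, hpm₀, List.map_append, List.map_cons, List.mem_toFinset, List.mem_filterMap, List.mem_append,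
      List.mem_cons, List.mem_map, Finset.mem_insert, Finset.mem_image, hFo]
    constructor
    · rintro ⟨p', hp', hpF⟩
      rcases hp' with ⟨p, hp, rfl⟩ | rfl | ⟨p, hp, rfl⟩
      · obtain ⟨f, -, hKf, hGf⟩ := harcP p hp
        rw [hKf] at hpF; cases hpF
        exact Or.inr ⟨f, ⟨p, Or.inl hp, hGf⟩, rfl⟩
      · rw [hxyK] at hpF; cases hpF; exact Or.inl rfl
      · obtain ⟨f, -, hKf, hGf⟩ := harcQ p hp
        rw [hKf] at hpF; cases hpF
        exact Or.inr ⟨f, ⟨p, Or.inr hp, hGf⟩, rfl⟩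
    · rintro (rfl | ⟨f, ⟨p, hp | hp, hGf⟩, rfl⟩)
      · exact ⟨_, Or.inr (Or.inl rfl), hxyK⟩
      · obtain ⟨f', -, hKf, hGf'⟩ := harcP p hp
        rw [hGf'] at hGf; cases hGf
        exact ⟨_, Or.inl ⟨p, hp, rfl⟩, hKf⟩
      · obtain ⟨f', -, hKf, hGf'⟩ := harcQ p hp
        rw [hGf'] at hGf; cases hGf
        exact ⟨_, Or.inr (Or.inr ⟨p, hp, rfl⟩), hKf⟩
  have hfacesG : (gridCx Θ').facesOf m₀' = insert O.gA (insert O.gB Fo) := by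
    ext f
    simp only [Cx.facesOf, hpm₀', List.mem_toFinset, List.mem_filterMap, List.mem_append, List.mem_cons, Finset.mem_insert, hFo]
    constructor
    · rintro ⟨p, hp | rfl | rfl | hp, hpf⟩
      · exact Or.inr (Or.inr ⟨p, Or.inl hp, hpf⟩)
      · rw [hA] at hpf; cases hpf; exact Or.inl rfl
      · rw [hB] at hpf; cases hpf; exact Or.inr (Or.inl rfl)
      · exact Or.inr (Or.inr ⟨p, Or.inr hp, hpf⟩)
    · rintro (rfl | rfl | ⟨p, hp | hp, hpf⟩)
      · exact ⟨_, Or.inr (Or.inl rfl), hA⟩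
      · exact ⟨_, Or.inr (Or.inr (Or.inl rfl)), hB⟩
      · exact ⟨p, Or.inl hp, hpf⟩
      · exact ⟨p, Or.inr (Or.inr (Or.inr hp)), hpf⟩
  -- kinds in the common faces
  have hkinds : ∀ f ∈ Fo, K.kindsIn (m₀.map Sum.inl) (.inl f) = (gridCx Θ').kindsIn m₀' f := by
    intro f hf
    have hfL := hFo_sub f hf
    have key : ∀ p ∈ pairsOf P ++ pairsOf Q,
        (if K.arcFace (im p) = some (Sum.inl f) then K.arcKindOf (im p) else none) =
          (if (gridCx Θ').arcFace p = some f then (gridCx Θ').arcKindOf p else none) := by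
      intro p hp
      obtain ⟨f', hf', hKf, hGf⟩ := harcPQ p hp
      rw [hKf, hGf]
      by_cases hff : f' = f
      · subst hff; rw [if_pos rfl, if_pos rfl]; exact I.emb.arcKindOf_map hGl hK hf' hGf
      · rw [if_neg (fun h => hff (Sum.inl_injective (Option.some_injective _ h))), if_neg (fun h => hff (Option.some_injective _ h))]
    unfold Cx.kindsIn
    rw [hpm, hpm₀, hpm₀', List.map_append, List.map_cons, List.filterMap_append, List.filterMap_append,
      List.filterMap_cons_none (by
        simp only [hxyK]
        exact if_neg fun h => by simp [rFace] at h),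
      List.filterMap_cons_none (by
        simp only [hA]
        exact if_neg fun h => O.hgA' (by rw [Option.some_injective _ h]; exact hfL)),
      List.filterMap_cons_none (by
        simp only [hB]
        exact if_neg fun h => O.hgB' (by rw [Option.some_injective _ h]; exact hfL)),
      List.filterMap_map, List.filterMap_map]
    congr 1
    · exact Cx.filterMap_congr_of_mem fun p hp => key p (List.mem_append_left _ hp)
    · exact Cx.filterMap_congr_of_mem fun p hp => key p (List.mem_append_right _ hp)
  have hkindr : K.kindsIn (m₀.map Sum.inl) rFace = [arcKind O.σx O.σy] := by
    have key : ∀ p ∈ pairsOf P ++ pairsOf Q, (if K.arcFace (im p) = some rFace then K.arcKindOf (im p) else none) = none := by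
      intro p hp
      obtain ⟨f', -, hKf, -⟩ := harcPQ p hp
      rw [hKf, if_neg]; exact fun h => by cases Option.some_injective _ h
    have hkxy : K.arcKindOf (im (O.x, O.y)) = some (arcKind O.σx O.σy) := by
      obtain ⟨s, t, -, hs, ht, hk⟩ := hK.exists_sides_of_arcFace hxyK
      rw [hk, hK.side_injective _ (hs.trans O.side_rx.symm), hK.side_injective _ (ht.trans O.side_ry.symm)]
    have hPnil : List.filterMap ((fun p => if K.arcFace p = some rFace then K.arcKindOf p else none) ∘ im) (pairsOf P) = [] :=
      List.filterMap_eq_nil_iff.2 fun p hp => key p (List.mem_append_left _ hp)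
    have hQnil : List.filterMap ((fun p => if K.arcFace p = some rFace then K.arcKindOf p else none) ∘ im) (pairsOf Q) = [] :=
      List.filterMap_eq_nil_iff.2 fun p hp => key p (List.mem_append_right _ hp)
    unfold Cx.kindsIn
    rw [hpm, hpm₀, List.map_append, List.map_cons, List.filterMap_append,
      List.filterMap_cons_some (b := arcKind O.σx O.σy) (by simp only [hxyK, if_true, hkxy]),
      List.filterMap_map, List.filterMap_map, hPnil, hQnil]
    rfl
  have hkindA : (gridCx Θ').kindsIn m₀' O.gA = [arcKind O.τA O.μA] := by
    have key : ∀ p ∈ pairsOf P ++ pairsOf Q, (if (gridCx Θ').arcFace p = some O.gA then (gridCx Θ').arcKindOf p else none) = none := by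
      intro p hp
      obtain ⟨f', hf', -, hGf⟩ := harcPQ p hp
      rw [hGf, if_neg]; exact fun h => O.hgA' (Option.some_injective _ h ▸ hf')
    have hk : (gridCx Θ').arcKindOf (O.x, I.mid) = some (arcKind O.τA O.μA) := by
      obtain ⟨s, t, -, hs, ht, hk⟩ := hGl.exists_sides_of_arcFace hA
      rw [hk, Face.side_injective _ (hs.trans O.hgAx.symm), Face.side_injective _ (ht.trans O.hgAm.symm)]
    have hPnil : List.filterMap (fun p => if (gridCx Θ').arcFace p = some O.gA then (gridCx Θ').arcKindOf p else none) (pairsOf P) = [] :=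
      List.filterMap_eq_nil_iff.2 fun p hp => key p (List.mem_append_left _ hp)
    have hQnil : List.filterMap (fun p => if (gridCx Θ').arcFace p = some O.gA then (gridCx Θ').arcKindOf p else none) (pairsOf Q) = [] :=
      List.filterMap_eq_nil_iff.2 fun p hp => key p (List.mem_append_right _ hp)
    unfold Cx.kindsIn
    rw [hpm₀', List.filterMap_append, List.filterMap_cons_some (b := arcKind O.τA O.μA) (by simp only [hA, if_true, hk]),
      List.filterMap_cons_none (by
        simp only [hB]
        exact if_neg fun h => O.hgAB (Option.some_injective _ h).symm),
      hPnil, hQnil]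
    rfl
  have hkindB : (gridCx Θ').kindsIn m₀' O.gB = [arcKind O.μB O.τB] := by
    have key : ∀ p ∈ pairsOf P ++ pairsOf Q, (if (gridCx Θ').arcFace p = some O.gB then (gridCx Θ').arcKindOf p else none) = none := by
      intro p hp
      obtain ⟨f', hf', -, hGf⟩ := harcPQ p hp
      rw [hGf, if_neg]; exact fun h => O.hgB' (Option.some_injective _ h ▸ hf')
    have hk : (gridCx Θ').arcKindOf (I.mid, O.y) = some (arcKind O.μB O.τB) := by
      obtain ⟨s, t, -, hs, ht, hk⟩ := hGl.exists_sides_of_arcFace hB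
      rw [hk, Face.side_injective _ (hs.trans O.hgBm.symm), Face.side_injective _ (ht.trans O.hgBy.symm)]
    have hPnil : List.filterMap (fun p => if (gridCx Θ').arcFace p = some O.gB then (gridCx Θ').arcKindOf p else none) (pairsOf P) = [] :=
      List.filterMap_eq_nil_iff.2 fun p hp => key p (List.mem_append_left _ hp)
    have hQnil : List.filterMap (fun p => if (gridCx Θ').arcFace p = some O.gB then (gridCx Θ').arcKindOf p else none) (pairsOf Q) = [] :=
      List.filterMap_eq_nil_iff.2 fun p hp => key p (List.mem_append_right _ hp)
    unfold Cx.kindsIn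
    rw [hpm₀', List.filterMap_append,
      List.filterMap_cons_none (by
        simp only [hA]
        exact if_neg fun h => O.hgAB (Option.some_injective _ h)),
      List.filterMap_cons_some (b := arcKind O.μB O.τB) (by simp only [hB, if_true, hk]),
      hPnil, hQnil]
    rfl
  -- assemble
  have hW : ∏ F ∈ Fo.image Sum.inl, localWeight (K.angle F) (K.kindsIn (m₀.map Sum.inl) F) =
      ∏ f ∈ Fo, localWeight ((gridCx Θ').angle f) ((gridCx Θ').kindsIn m₀' f) := by
    rw [Finset.prod_image fun f _ g _ h => Sum.inl_injective h]
    refine Finset.prod_congr rfl fun f hf => ?_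
    rw [I.hang f (hFo_sub f hf), hkinds f hf]; rfl
  have hr_not : rFace ∉ Fo.image Sum.inl := by simp [rFace]
  have hA_not : O.gA ∉ insert O.gB Fo := by
    rw [Finset.mem_insert, not_or]; exact ⟨O.hgAB, fun h => O.hgA' (hFo_sub _ h)⟩
  have hB_not : O.gB ∉ Fo := fun h => O.hgB' (hFo_sub _ h)
  rw [Cx.weight, Cx.weight, hfacesK, hfacesG, Finset.prod_insert hr_not, Finset.prod_insert hA_not, Finset.prod_insert hB_not,
    hW, hkindr, hkindA, hkindB]
  simp only [gridCx]
  ring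

end InsData

end Surgery

section Wrapper

variable {T L : ℕ} {K : Cx DFace DEdge} {Θ' : ℤ → ℝ}

/-- Grid weights are non-negative for angles in `[π/3, 2π/3]` (any edge list). [cite: GlazmanManolescu2019, §1] -/
theorem gridCx_weight_nonneg (hΘ' : ∀ k, Θ' k ∈ Set.Icc (π / 3) (2 * π / 3)) (w : List MidEdge) :
    0 ≤ (gridCx Θ').weight w :=
  Finset.prod_nonneg fun f _ => localWeight_nonneg (hΘ' f.1) _

/-- The real partition sum of the grid is monotone in the domain (non-negative weights). [folklore] -/
theorem gridCx_wsum_mono (hΘ' : ∀ k, Θ' k ∈ Set.Icc (π / 3) (2 * π / 3)) {D D' : Set Face} (hDD' : D ⊆ D')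
    (hD' : D'.Finite) (a b : MidEdge) : (gridCx Θ').wsum D a b ≤ (gridCx Θ').wsum D' a b := by
  unfold Cx.wsum
  refine Finset.sum_le_sum_of_subset_of_nonneg (fun m hm => ?_) fun m _ _ => gridCx_weight_nonneg hΘ' m
  rw [Cx.mem_walkFinset _ ((gridCx Θ').walkSet_finite (gridCx_lawful Θ') hD' a b)]
  exact ((Cx.mem_walkFinset _ ((gridCx Θ').walkSet_finite (gridCx_lawful Θ') (hD'.subset hDD') a b)).1 hm).mono hDD'

namespace InsData

variable (I : InsData K Θ' T L) (hK : K.Lawful)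
include hK

/-- Erasing the inserted edge recovers the original walk. [folklore] -/
theorem erase_mid (O : I.OrData) {a b : MidEdge} (ha : a ≠ I.mid) {u v : List MidEdge}
    (hm : K.IsWalk (defDom T L) (.inl a) (.inl b) ((u ++ O.x :: O.y :: v).map Sum.inl)) :
    (u ++ O.x :: I.mid :: O.y :: v).erase I.mid = u ++ O.x :: O.y :: v := by
  have hvalid := (O.surgery hK ha hm).1
  have hnd := hvalid.nodup
  rw [show u ++ O.x :: I.mid :: O.y :: v = (u ++ [O.x]) ++ I.mid :: (O.y :: v) by simp] at hnd ⊢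
  rw [List.nodup_middle, List.nodup_cons] at hnd
  rw [List.erase_append_right _ (fun h => hnd.1 (List.mem_append_left _ h)), List.erase_cons_head]
  simp

/-- **The bound on the walks through the added rhombus**: their total weight, times the product of
the local weights of the two re-routing arcs, is at most the local weight of the arc in `r` times
`G_{Rect_{T,L+1}}(a,b) − G_{Rect_{T,L}}(a,b)` ("`G_{D_0}(a,b) − G_{Rect_{T,L}(Θ)}(a,b) ≤
c (G_{Rect_{T,L+1}(Θ)}(a,b) − G_{Rect_{T,L}(Θ)}(a,b))`"). [cite: GlazmanManolescu2019, §4.2] -/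
theorem sum_visiting_mul_le (hΘ' : ∀ k, Θ' k ∈ Set.Icc (π / 3) (2 * π / 3)) {a b : MidEdge}
    (ha : a ≠ I.mid) (hc : 0 ≤ localWeight (K.angle rFace) [arcKind I.σ₁ I.σ₂]) :
    (∑ m ∈ (K.walkFinset (defDom T L) (.inl a) (.inl b)).filter (fun m => rFace ∈ K.facesOf m), K.weight m) *
        (localWeight (Θ' I.g₁.1) [arcKind I.τ₁ I.μ₁] * localWeight (Θ' I.g₂.1) [arcKind I.μ₂ I.τ₂]) ≤
      localWeight (K.angle rFace) [arcKind I.σ₁ I.σ₂] *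
        ((gridCx Θ').wsum (rect T (L + 1)) a b - (gridCx Θ').wsum (rect T L) a b) := by
  classical
  set S := (K.walkFinset (defDom T L) (.inl a) (.inl b)).filter (fun m => rFace ∈ K.facesOf m) with hS
  have hfin := K.walkSet_finite hK (defDom_finite T L) (Sum.inl a) (Sum.inl b)
  have hmemS : ∀ m ∈ S, K.IsWalk (defDom T L) (.inl a) (.inl b) m ∧ rFace ∈ K.facesOf m := fun m hm => by
    rw [hS, Finset.mem_filter, K.mem_walkFinset hfin] at hm; exact hm
  -- the re-routing map
  have hex : ∀ m ∈ S, ∃ (w : List MidEdge) (O : I.OrData) (u v : List MidEdge), (O = I.or₁ ∨ O = I.or₂) ∧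
      m = (u ++ O.x :: O.y :: v).map Sum.inl ∧ w = u ++ O.x :: I.mid :: O.y :: v := by
    intro m hm
    obtain ⟨hw, hr⟩ := hmemS m hm
    obtain ⟨u, v, x, y, hxy, rfl⟩ := I.exists_split hK hw hr
    rcases hxy with h | h <;> obtain ⟨rfl, rfl⟩ := Prod.mk.inj h
    · exact ⟨_, I.or₁, u, v, Or.inl rfl, rfl, rfl⟩
    · exact ⟨_, I.or₂, u, v, Or.inr rfl, rfl, rfl⟩
  haveI : Nonempty I.OrData := ⟨I.or₁⟩
  choose! Φ O U V hOr hΦm hΦw using hex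
  -- constants
  set cA := localWeight (Θ' I.g₁.1) [arcKind I.τ₁ I.μ₁] with hcA
  set cB := localWeight (Θ' I.g₂.1) [arcKind I.μ₂ I.τ₂] with hcB
  set cr := localWeight (K.angle rFace) [arcKind I.σ₁ I.σ₂] with hcr
  have hconst : ∀ O : I.OrData, (O = I.or₁ ∨ O = I.or₂) →
      localWeight (Θ' O.gA.1) [arcKind O.τA O.μA] * localWeight (Θ' O.gB.1) [arcKind O.μB O.τB] = cA * cB ∧
        localWeight (K.angle rFace) [arcKind O.σx O.σy] = cr ∧ (O.gA = I.g₁ ∨ O.gA = I.g₂) := by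
    rintro O (rfl | rfl)
    · exact ⟨rfl, rfl, Or.inl rfl⟩
    · refine ⟨?_, ?_, Or.inr rfl⟩
      · change localWeight (Θ' I.g₂.1) [arcKind I.τ₂ I.μ₂] * localWeight (Θ' I.g₁.1) [arcKind I.μ₁ I.τ₁] = cA * cB
        rw [hcA, hcB, arcKind_comm I.τ₂, arcKind_comm I.μ₁, mul_comm]
      · change localWeight (K.angle rFace) [arcKind I.σ₂ I.σ₁] = cr
        rw [hcr, arcKind_comm]
  -- the surgery, walk by walk
  have hsur : ∀ m ∈ S, (gridCx Θ').IsWalk (rect T (L + 1)) a b (Φ m) ∧ (O m).gA ∈ (gridCx Θ').facesOf (Φ m) ∧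
      K.weight m * (cA * cB) = (gridCx Θ').weight (Φ m) * cr := by
    intro m hm
    obtain ⟨hw, -⟩ := hmemS m hm
    have hm' := hΦm m hm
    rw [hm'] at hw
    obtain ⟨h1, h2, h3⟩ := (O m).surgery hK ha hw
    obtain ⟨hc1, hc2, -⟩ := hconst (O m) (hOr m hm)
    rw [← hΦw m hm] at h1 h2 h3
    rw [hc1, hc2, ← hm'] at h3
    exact ⟨h1, h2, h3⟩
  have hinj : Set.InjOn Φ ↑S := by
    intro m hm m' hm' h
    have e := I.erase_mid hK (O m) ha (by rw [← hΦm m hm]; exact (hmemS m hm).1)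
    have e' := I.erase_mid hK (O m') ha (by rw [← hΦm m' hm']; exact (hmemS m' hm').1)
    rw [← hΦw m hm] at e
    rw [← hΦw m' hm'] at e'
    rw [hΦm m hm, hΦm m' hm', ← e, ← e', h]
  -- the target set of walks
  set W := ((gridCx Θ').walkFinset (rect T (L + 1)) a b).filter
    (fun w => I.g₁ ∈ (gridCx Θ').facesOf w ∨ I.g₂ ∈ (gridCx Θ').facesOf w) with hW
  have hfinG := (gridCx Θ').walkSet_finite (gridCx_lawful Θ') (rect_finite T (L + 1)) a b
  have himage : S.image Φ ⊆ W := by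
    intro w hw
    obtain ⟨m, hm, rfl⟩ := Finset.mem_image.1 hw
    obtain ⟨h1, h2, -⟩ := hsur m hm
    rw [hW, Finset.mem_filter, Cx.mem_walkFinset _ hfinG]
    refine ⟨h1, ?_⟩
    rcases (hconst (O m) (hOr m hm)).2.2 with h | h
    · exact Or.inl (h ▸ h2)
    · exact Or.inr (h ▸ h2)
  -- the sums
  have step1 : (∑ m ∈ S, K.weight m) * (cA * cB) = cr * ∑ w ∈ S.image Φ, (gridCx Θ').weight w := by
    rw [Finset.sum_mul, Finset.sum_image hinj, Finset.mul_sum]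
    exact Finset.sum_congr rfl fun m hm => by rw [(hsur m hm).2.2, mul_comm]
  have step2 : ∑ w ∈ S.image Φ, (gridCx Θ').weight w ≤ ∑ w ∈ W, (gridCx Θ').weight w :=
    Finset.sum_le_sum_of_subset_of_nonneg himage fun w _ _ => gridCx_weight_nonneg hΘ' w
  have step3 : ∑ w ∈ W, (gridCx Θ').weight w ≤ (gridCx Θ').wsum (rect T (L + 1)) a b - (gridCx Θ').wsum (rect T L) a b := by
    have hsplit := Finset.sum_filter_add_sum_filter_not ((gridCx Θ').walkFinset (rect T (L + 1)) a b)
      (fun w => I.g₁ ∈ (gridCx Θ').facesOf w ∨ I.g₂ ∈ (gridCx Θ').facesOf w) (gridCx Θ').weight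
    have hrest : (gridCx Θ').wsum (rect T L) a b ≤
        ∑ w ∈ ((gridCx Θ').walkFinset (rect T (L + 1)) a b).filter
          (fun w => ¬(I.g₁ ∈ (gridCx Θ').facesOf w ∨ I.g₂ ∈ (gridCx Θ').facesOf w)), (gridCx Θ').weight w := by
      unfold Cx.wsum
      refine Finset.sum_le_sum_of_subset_of_nonneg (fun w hw => ?_) fun w _ _ => gridCx_weight_nonneg hΘ' w
      have hwL := (Cx.mem_walkFinset _ ((gridCx Θ').walkSet_finite (gridCx_lawful Θ') (rect_finite T L) a b)).1 hw
      rw [Finset.mem_filter, Cx.mem_walkFinset _ hfinG]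
      refine ⟨hwL.mono fun f hf => rect_mono_succ hf, ?_⟩
      rintro (h | h)
      · exact I.hg₁' (hwL.facesOf_subset h)
      · exact I.hg₂' (hwL.facesOf_subset h)
    unfold Cx.wsum at hrest ⊢
    rw [← hW] at hsplit
    linarith
  rw [step1]
  exact mul_le_mul_of_nonneg_left (step2.trans step3) hc

end InsData

end Wrapper

/-! ### The two ends of the sliding -/

section Ends

variable {T L : ℕ} (Θ : ℤ → ℝ) (i : ℤ)

/-- `arcKind` values used below. [cite: GlazmanManolescu2019, Fig. 1] -/
theorem localWeight_corner (θ : ℝ) : localWeight θ [ArcKind.corner] = weightU1 θ := rfl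

/-- `arcKind` values used below. [cite: GlazmanManolescu2019, Fig. 1] -/
theorem localWeight_coCorner (θ : ℝ) : localWeight θ [ArcKind.coCorner] = weightU2 θ := rfl

/-- **The top end**: the data of the re-routing for `D_{L+1}` (the added rhombus on top of the
columns `i, i+1` of `Rect_{T,L}`; its arc `W → S` is replaced by the arcs `S → E` of `(i, L+1)` and
`W → S` of `(i+1, L+1)`). [cite: GlazmanManolescu2019, §4.2 ("two arcs in the top row of Rect_{T,L+1}(Θ)")] -/
def insTop (hi : 0 ≤ i) (hiT : i + 2 ≤ T) : InsData (defCx Θ i (L + 1)) Θ T L where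
  e₁ := .slant i (L + 1)
  e₂ := .slant (i + 1) (L + 1)
  mid := .vert (i + 1) (L + 1)
  σ₁ := .W
  σ₂ := .S
  g₁ := (i, L + 1)
  g₂ := (i + 1, L + 1)
  τ₁ := .S
  μ₁ := .E
  μ₂ := .W
  τ₂ := .S
  hσ := by decide
  side_r₁ := rfl
  side_r₂ := rfl
  other_inr σ h1 h2 := by
    cases σ
    exacts [absurd rfl h1, ⟨.E, rfl⟩, absurd rfl h2, ⟨.N, rfl⟩]
  hag f hf s := by
    change dside i (L + 1) (.inl f) s = _
    refine dside_inl_of_not i (L + 1) (fun h => ?_) (fun h => ?_) <;>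
    · have := hf.2.2.2; rw [h.1] at this; push_cast at this; omega
  hang f hf := by
    change dangle Θ i (L + 1) (.inl f) = Θ f.1
    simp only [dangle]
    rw [if_neg]
    have := hf.2.2.2; omega
  hg₁e := rfl
  hg₁m := rfl
  hg₂m := rfl
  hg₂e := rfl
  hτμ₁ := by decide
  hτμ₂ := by decide
  hg₁₂ := by simp
  hg₁ := ⟨hi, by omega, by push_cast; omega, by push_cast; omega⟩
  hg₂ := ⟨by omega, by omega, by push_cast; omega, by push_cast; omega⟩
  hg₁' h := by have := h.2.2.2; omega
  hg₂' h := by have := h.2.2.2; omega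
  hmid f hf s := by
    have := hf.2.2.2
    cases s <;> simp [Face.side] <;> omega
  hmid₁ := by simp
  hmid₂ := by simp

/-- **The bottom end**: `D_{−L}` with its edges re-labelled (`ρN ↔ slant i (−L)`,
`ρE ↔ slant (i+1) (−L)`) so as to agree with the grid `Θ ∘ τ_i` on the whole rectangle; the added
rhombus hangs below the columns `i, i+1`. [cite: GlazmanManolescu2019, §4.2 ("the rhombic tiling Rect_{T,L}(Θ∘τ_i) with the additional added rhombus at the bottom")] -/
def botCx (L : ℕ) : Cx DFace DEdge := (defCx Θ i (-L)).relabel (moveψ i (-L))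

/-- The bottom complex is lawful. [folklore] -/
theorem botCx_lawful (L : ℕ) : (botCx Θ i L).Lawful := Cx.relabel_lawful (defCx_lawful i (-L) Θ) _

/-- The sides of the bottom complex. [folklore] -/
theorem botCx_side (L : ℕ) (f : DFace) (s : Side) : (botCx Θ i L).side f s = moveψ i (-L) (dside i (-L) f s) := rfl

/-- The data of the re-routing for the bottom end: the arc `N → E` of the added rhombus is replaced
by the arcs `N → E` of `(i, −L−1)` and `W → N` of `(i+1, −L−1)` in the grid `Θ ∘ τ_i`.
[cite: GlazmanManolescu2019, §4.2 ("By the same reasoning as above")] -/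
def insBot (hi : 0 ≤ i) (hiT : i + 2 ≤ T) : InsData (botCx Θ i L) (Θ ∘ Equiv.swap i (i + 1)) T L where
  e₁ := .slant i (-L)
  e₂ := .slant (i + 1) (-L)
  mid := .vert (i + 1) (-L - 1)
  σ₁ := .N
  σ₂ := .E
  g₁ := (i, -L - 1)
  g₂ := (i + 1, -L - 1)
  τ₁ := .N
  μ₁ := .E
  μ₂ := .W
  τ₂ := .N
  hσ := by decide
  side_r₁ := by rw [botCx_side]; exact moveψ_ρN i (-L)
  side_r₂ := by rw [botCx_side]; exact moveψ_ρE i (-L)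
  other_inr σ h1 h2 := by
    cases σ
    · exact ⟨.N, by rw [botCx_side]; exact moveψ_slant_left i (-L)⟩
    · exact absurd rfl h2
    · exact ⟨.E, by rw [botCx_side]; exact moveψ_slant_right i (-L)⟩
    · exact absurd rfl h1
  hag f hf s := by
    rw [botCx_side]
    obtain ⟨k, j⟩ := f
    obtain ⟨hk0, hkT, hjL, hjL'⟩ := hf
    simp only at hk0 hkT hjL hjL'
    by_cases h1 : (k, j) = (i, -(L : ℤ)) ∧ s = .S
    · obtain ⟨hkj, rfl⟩ := h1
      cases hkj
      rw [show dside i (-L) (.inl (i, -(L : ℤ))) .S = ρN by simp [dside], moveψ_ρN]; rfl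
    · by_cases h2 : (k, j) = (i + 1, -(L : ℤ)) ∧ s = .S
      · obtain ⟨hkj, rfl⟩ := h2
        cases hkj
        rw [show dside i (-L) (.inl (i + 1, -(L : ℤ))) .S = ρE by simp [dside], moveψ_ρE]; rfl
      · rw [dside_inl_of_not i (-L) h1 h2]
        refine moveψ_of_ne i (-L) (by simp [ρN]) (by simp [ρE]) (fun e => ?_) (fun e => ?_)
        · cases s <;> simp [Face.side] at e
          · exact h1 ⟨by rw [e.1, e.2], rfl⟩
          · omega
        · cases s <;> simp [Face.side] at e
          · exact h2 ⟨by rw [e.1, e.2], rfl⟩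
          · omega
  hang f hf := by
    change dangle Θ i (-L) (.inl f) = (Θ ∘ Equiv.swap i (i + 1)) f.1
    simp only [dangle, Function.comp_apply]
    rw [if_pos hf.2.2.1]
  hg₁e := by simp [Face.side]
  hg₁m := rfl
  hg₂m := rfl
  hg₂e := by simp [Face.side]
  hτμ₁ := by decide
  hτμ₂ := by decide
  hg₁₂ := by simp
  hg₁ := ⟨hi, by omega, by push_cast; omega, by push_cast; omega⟩
  hg₂ := ⟨by omega, by omega, by push_cast; omega, by push_cast; omega⟩
  hg₁' h := by have := h.2.2.1; omega
  hg₂' h := by have := h.2.2.1; omega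
  hmid f hf s := by
    have := hf.2.2.1
    cases s <;> simp [Face.side] <;> omega
  hmid₁ := by simp
  hmid₂ := by simp

variable {Θ i}

/-- The domain minus the added rhombus is the rectangle. [folklore] -/
theorem defDom_diff_rFace : defDom T L \ {rFace} = Sum.inl '' rect T L := by
  ext F
  constructor
  · rintro ⟨hF | hF, hr⟩
    · exact hF
    · exact absurd hF hr
  · rintro ⟨f, hf, rfl⟩
    exact ⟨Or.inl ⟨f, hf, rfl⟩, fun h => by simp [rFace] at h⟩

/-- **`G_{D}(a,b) = G_{Rect_{T,L}}(a,b) + Σ_{γ uses r} w(γ)`** for a complex agreeing with the grid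
`Θ'` on the rectangle. [cite: GlazmanManolescu2019, §4.2 ("G_{D_0}(a,b) − G_{Rect_{T,L}(Θ)}(a,b) = Σ_{γ uses r} w(γ)")] -/
theorem InsData.wsum_eq_grid_add {K : Cx DFace DEdge} {Θ' : ℤ → ℝ} (I : InsData K Θ' T L) (hK : K.Lawful) (a b : MidEdge) :
    K.wsum (defDom T L) (.inl a) (.inl b) = (gridCx Θ').wsum (rect T L) a b +
      ∑ m ∈ (K.walkFinset (defDom T L) (.inl a) (.inl b)).filter (fun m => rFace ∈ K.facesOf m), K.weight m := by
  rw [K.wsum_eq_wsum_diff_add hK (defDom_finite T L) rFace, defDom_diff_rFace]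
  congr 1
  exact I.emb.wsum_eq (gridCx_lawful Θ') hK (rect_finite T L) a b

/-- `u₂ ≥ 0` at the angle of the added rhombus, `θ₂ − θ₁ ∈ [0, π/3]`. [cite: GlazmanManolescu2019, §4.2 ("A path … traverses r only as one arc, hence always has positive weight")] -/
theorem weightU2_sub_nonneg {θ₁ θ₂ : ℝ} (h₁ : θ₁ ∈ Set.Icc (π / 3) (2 * π / 3)) (h₂ : θ₂ ∈ Set.Icc (π / 3) (2 * π / 3))
    (hle : θ₁ ≤ θ₂) : 0 ≤ weightU2 (θ₂ - θ₁) := by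
  obtain ⟨a1, b1⟩ := h₁; obtain ⟨a2, b2⟩ := h₂
  have hpi := Real.pi_pos
  unfold weightU2 weightDen
  refine div_nonneg_of_nonpos (mul_nonpos_of_nonpos_of_nonneg sin_five_pi_div_four_neg.le
    (Real.sin_nonneg_of_nonneg_of_le_pi (by linarith) (by linarith))) (mul_nonpos_of_nonpos_of_nonneg ?_ ?_)
  · have : 0 < Real.sin (5 * π / 4 + 3 * (θ₂ - θ₁) / 8 - π) := Real.sin_pos_of_pos_of_lt_pi (by linarith) (by linarith)
    rw [Real.sin_sub_pi] at this
    linarith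
  · exact (Real.sin_pos_of_pos_of_lt_pi (by linarith) (by linarith)).le

/-- `u₁ > 0` on `[π/3, 2π/3]`. [cite: GlazmanManolescu2019, §1] -/
theorem weightU1_pos {θ : ℝ} (hθ : θ ∈ Set.Icc (π / 3) (2 * π / 3)) : 0 < weightU1 θ :=
  div_pos_of_neg_of_neg (mul_neg_of_neg_of_pos sin_five_pi_div_four_neg (sin_five_pi_div_eight_add_pos hθ)) (weightDen_neg hθ)

/-- `u₂ > 0` on `[π/3, 2π/3]`. [cite: GlazmanManolescu2019, §1] -/
theorem weightU2_pos {θ : ℝ} (hθ : θ ∈ Set.Icc (π / 3) (2 * π / 3)) : 0 < weightU2 θ :=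
  div_pos_of_neg_of_neg (mul_neg_of_neg_of_pos sin_five_pi_div_four_neg (sin_three_mul_div_eight_pos hθ)) (weightDen_neg hθ)

/-- **The top end of the sliding**: `G_{D_{L+1}}(a,b) = G_{Rect_{T,L}(Θ)}(a,b) + E_L` with
`0 ≤ E_L` and `E_L · u₁(θ_i) u₂(θ_{i+1}) ≤ u₂(θ_{i+1} − θ_i) (G_{Rect_{T,L+1}(Θ)}(a,b) − G_{Rect_{T,L}(Θ)}(a,b))`.
[cite: GlazmanManolescu2019, §4.2] -/
theorem top_end (hΘ : ∀ k, Θ k ∈ Set.Icc (π / 3) (2 * π / 3)) (hi : 0 ≤ i) (hiT : i + 2 ≤ T) (hle : Θ i ≤ Θ (i + 1))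
    (L : ℕ) (a b : MidEdge) (ha : ∀ k j, a = .vert k j → k ≠ i + 1) :
    ∃ E : ℝ, (defCx Θ i (L + 1)).wsum (defDom T L) (.inl a) (.inl b) = (gridCx Θ).wsum (rect T L) a b + E ∧ 0 ≤ E ∧
      E * (weightU1 (Θ i) * weightU2 (Θ (i + 1))) ≤
        weightU2 (Θ (i + 1) - Θ i) * ((gridCx Θ).wsum (rect T (L + 1)) a b - (gridCx Θ).wsum (rect T L) a b) := by
  set I := insTop (L := L) Θ i hi hiT with hI
  have hK := defCx_lawful i ((L : ℤ) + 1) Θ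
  refine ⟨_, I.wsum_eq_grid_add hK a b, ?_, ?_⟩
  · refine Finset.sum_nonneg fun m hm => ?_
    -- a walk of `D_{L+1}` weighs `≥ 0`: its faces are rectangle faces (angles in range) or `r` (`u₂ ≥ 0`)
    rw [Finset.mem_filter, Cx.mem_walkFinset _ ((defCx Θ i (L + 1)).walkSet_finite hK (defDom_finite T L) _ _)] at hm
    obtain ⟨hw, hr⟩ := hm
    obtain ⟨u, v, x, y, hxy, rfl⟩ := I.exists_split hK hw hr
    have hamid : a ≠ I.mid := fun h => ha (i + 1) (L + 1) h rfl
    rcases hxy with h | h <;> obtain ⟨rfl, rfl⟩ := Prod.mk.inj h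
    · have h3 := (I.or₁.surgery hK hamid hw).2.2
      have hpos : 0 < localWeight (Θ I.or₁.gA.1) [arcKind I.or₁.τA I.or₁.μA] * localWeight (Θ I.or₁.gB.1) [arcKind I.or₁.μB I.or₁.τB] :=
        mul_pos (weightU1_pos (hΘ i)) (weightU2_pos (hΘ (i + 1)))
      have hnn : 0 ≤ (gridCx Θ).weight (u ++ I.or₁.x :: I.mid :: I.or₁.y :: v) * localWeight ((defCx Θ i (L + 1)).angle rFace) [arcKind I.or₁.σx I.or₁.σy] :=
        mul_nonneg (gridCx_weight_nonneg hΘ _) (weightU2_sub_nonneg (hΘ i) (hΘ (i + 1)) hle)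
      rw [← h3] at hnn
      exact nonneg_of_mul_nonneg_left hnn hpos
    · have h3 := (I.or₂.surgery hK hamid hw).2.2
      have hpos : 0 < localWeight (Θ I.or₂.gA.1) [arcKind I.or₂.τA I.or₂.μA] * localWeight (Θ I.or₂.gB.1) [arcKind I.or₂.μB I.or₂.τB] :=
        mul_pos (weightU2_pos (hΘ (i + 1))) (weightU1_pos (hΘ i))
      have hnn : 0 ≤ (gridCx Θ).weight (u ++ I.or₂.x :: I.mid :: I.or₂.y :: v) * localWeight ((defCx Θ i (L + 1)).angle rFace) [arcKind I.or₂.σx I.or₂.σy] :=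
        mul_nonneg (gridCx_weight_nonneg hΘ _) (weightU2_sub_nonneg (hΘ i) (hΘ (i + 1)) hle)
      rw [← h3] at hnn
      exact nonneg_of_mul_nonneg_left hnn hpos
  · have hamid : a ≠ I.mid := fun h => ha (i + 1) (L + 1) h rfl
    exact I.sum_visiting_mul_le hK hΘ hamid (weightU2_sub_nonneg (hΘ i) (hΘ (i + 1)) hle)

/-- **The bottom end of the sliding**: `G_{D_{−L}}(a,b) = G_{Rect_{T,L}(Θ ∘ τ_i)}(a,b) + F_L` with
`0 ≤ F_L` and `F_L · u₁(θ_i) u₂(θ_{i+1}) ≤ u₂(θ_{i+1} − θ_i) (G_{Rect_{T,L+1}(Θ∘τ_i)}(a,b) − G_{Rect_{T,L}(Θ∘τ_i)}(a,b))`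
(boundary points: vertical edges not in column `i + 1`). [cite: GlazmanManolescu2019, §4.2 ("By the same reasoning as above")] -/
theorem bottom_end (hΘ : ∀ k, Θ k ∈ Set.Icc (π / 3) (2 * π / 3)) (hi : 0 ≤ i) (hiT : i + 2 ≤ T) (hle : Θ i ≤ Θ (i + 1))
    (L : ℕ) (k j k' j' : ℤ) (hk : k ≠ i + 1) :
    ∃ F : ℝ, (defCx Θ i (-L)).wsum (defDom T L) (.inl (.vert k j)) (.inl (.vert k' j')) =
        (gridCx (Θ ∘ Equiv.swap i (i + 1))).wsum (rect T L) (.vert k j) (.vert k' j') + F ∧ 0 ≤ F ∧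
      F * (weightU1 (Θ i) * weightU2 (Θ (i + 1))) ≤
        weightU2 (Θ (i + 1) - Θ i) * ((gridCx (Θ ∘ Equiv.swap i (i + 1))).wsum (rect T (L + 1)) (.vert k j) (.vert k' j') -
          (gridCx (Θ ∘ Equiv.swap i (i + 1))).wsum (rect T L) (.vert k j) (.vert k' j')) := by
  set I := insBot (L := L) Θ i hi hiT with hI
  have hK := botCx_lawful Θ i L
  have hΘ' : ∀ k, (Θ ∘ Equiv.swap i (i + 1)) k ∈ Set.Icc (π / 3) (2 * π / 3) := fun k => hΘ _
  have hrel : (defCx Θ i (-L)).wsum (defDom T L) (.inl (.vert k j)) (.inl (.vert k' j')) =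
      (botCx Θ i L).wsum (defDom T L) (.inl (.vert k j)) (.inl (.vert k' j')) := by
    rw [botCx, ← Cx.wsum_relabel (defCx_lawful i (-L) Θ) (moveψ i (-L)) (defDom_finite T L), moveψ_vert, moveψ_vert]
  rw [hrel]
  have hamid : MidEdge.vert k j ≠ I.mid := fun h => hk (by cases h; rfl)
  refine ⟨_, I.wsum_eq_grid_add hK _ _, ?_, ?_⟩
  · refine Finset.sum_nonneg fun m hm => ?_
    rw [Finset.mem_filter, Cx.mem_walkFinset _ ((botCx Θ i L).walkSet_finite hK (defDom_finite T L) _ _)] at hm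
    obtain ⟨hw, hr⟩ := hm
    obtain ⟨u, v, x, y, hxy, rfl⟩ := I.exists_split hK hw hr
    rcases hxy with h | h <;> obtain ⟨rfl, rfl⟩ := Prod.mk.inj h
    · have h3 := (I.or₁.surgery hK hamid hw).2.2
      have hpos : 0 < localWeight ((Θ ∘ Equiv.swap i (i + 1)) I.or₁.gA.1) [arcKind I.or₁.τA I.or₁.μA] *
          localWeight ((Θ ∘ Equiv.swap i (i + 1)) I.or₁.gB.1) [arcKind I.or₁.μB I.or₁.τB] := by
        refine mul_pos ?_ ?_
        · change 0 < localWeight (Θ (Equiv.swap i (i + 1) i)) [ArcKind.coCorner]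
          rw [Equiv.swap_apply_left]; exact weightU2_pos (hΘ (i + 1))
        · change 0 < localWeight (Θ (Equiv.swap i (i + 1) (i + 1))) [ArcKind.corner]
          rw [Equiv.swap_apply_right]; exact weightU1_pos (hΘ i)
      have hnn : 0 ≤ (gridCx (Θ ∘ Equiv.swap i (i + 1))).weight (u ++ I.or₁.x :: I.mid :: I.or₁.y :: v) *
          localWeight ((botCx Θ i L).angle rFace) [arcKind I.or₁.σx I.or₁.σy] :=
        mul_nonneg (gridCx_weight_nonneg hΘ' _) (weightU2_sub_nonneg (hΘ i) (hΘ (i + 1)) hle)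
      rw [← h3] at hnn
      exact nonneg_of_mul_nonneg_left hnn hpos
    · have h3 := (I.or₂.surgery hK hamid hw).2.2
      have hpos : 0 < localWeight ((Θ ∘ Equiv.swap i (i + 1)) I.or₂.gA.1) [arcKind I.or₂.τA I.or₂.μA] *
          localWeight ((Θ ∘ Equiv.swap i (i + 1)) I.or₂.gB.1) [arcKind I.or₂.μB I.or₂.τB] := by
        refine mul_pos ?_ ?_
        · change 0 < localWeight (Θ (Equiv.swap i (i + 1) (i + 1))) [ArcKind.corner]
          rw [Equiv.swap_apply_right]; exact weightU1_pos (hΘ i)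
        · change 0 < localWeight (Θ (Equiv.swap i (i + 1) i)) [ArcKind.coCorner]
          rw [Equiv.swap_apply_left]; exact weightU2_pos (hΘ (i + 1))
      have hnn : 0 ≤ (gridCx (Θ ∘ Equiv.swap i (i + 1))).weight (u ++ I.or₂.x :: I.mid :: I.or₂.y :: v) *
          localWeight ((botCx Θ i L).angle rFace) [arcKind I.or₂.σx I.or₂.σy] :=
        mul_nonneg (gridCx_weight_nonneg hΘ' _) (weightU2_sub_nonneg (hΘ i) (hΘ (i + 1)) hle)
      rw [← h3] at hnn
      exact nonneg_of_mul_nonneg_left hnn hpos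
  · have := I.sum_visiting_mul_le hK hΘ' (b := .vert k' j') hamid (weightU2_sub_nonneg (hΘ i) (hΘ (i + 1)) hle)
    have hc : localWeight ((Θ ∘ Equiv.swap i (i + 1)) I.g₁.1) [arcKind I.τ₁ I.μ₁] * localWeight ((Θ ∘ Equiv.swap i (i + 1)) I.g₂.1) [arcKind I.μ₂ I.τ₂] =
        weightU1 (Θ i) * weightU2 (Θ (i + 1)) := by
      change localWeight (Θ (Equiv.swap i (i + 1) i)) [ArcKind.coCorner] * localWeight (Θ (Equiv.swap i (i + 1) (i + 1))) [ArcKind.corner] = _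
      rw [Equiv.swap_apply_left, Equiv.swap_apply_right, localWeight_coCorner, localWeight_corner, mul_comm]
    rwa [hc] at this

end Ends

/-! ## Taking `L → ∞`, and general permutations -/

section Limit

open Filter Topology

/-- **The limit step.** If `X_L + E_L = Y_L + F_L` with `X` monotone, `E ≥ 0` and
`F_L ≤ c (Y_{L+1} − Y_L)`, then `sup_L X_L ≤ sup_L Y_L` (in `[0, ∞]`, through `ofReal`): when
`sup Y < ∞` the increments of `Y`, hence `F_L`, tend to `0`. [cite: GlazmanManolescu2019, §4.2 ("the right-hand side of the above converges to G_{Strip_T(Θ)}(a,b) as L → ∞")] -/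
theorem iSup_ofReal_le_of_coupled {X Y E F : ℕ → ℝ} {c : ℝ} (hX : Monotone X) (hY : Monotone Y)
    (hXY : ∀ L, X L + E L = Y L + F L) (hE : ∀ L, 0 ≤ E L) (hF : ∀ L, F L ≤ c * (Y (L + 1) - Y L)) :
    (⨆ L, ENNReal.ofReal (X L)) ≤ ⨆ L, ENNReal.ofReal (Y L) := by
  refine iSup_le fun L => ENNReal.le_of_forall_pos_le_add fun ε hε hb => ?_
  set b := ⨆ L, ENNReal.ofReal (Y L) with hbdef
  have hYle : ∀ M, Y M ≤ b.toReal := fun M =>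
    (ENNReal.ofReal_le_iff_le_toReal hb.ne).1 (le_iSup (fun L => ENNReal.ofReal (Y L)) M)
  have hbdd : BddAbove (Set.range Y) := ⟨b.toReal, by rintro _ ⟨M, rfl⟩; exact hYle M⟩
  have hconv : Tendsto Y atTop (𝓝 (⨆ M, Y M)) := tendsto_atTop_ciSup hY hbdd
  have hincr : Tendsto (fun M => c * (Y (M + 1) - Y M)) atTop (𝓝 0) := by
    have h1 : Tendsto (fun M => Y (M + 1)) atTop (𝓝 (⨆ M, Y M)) := (tendsto_add_atTop_iff_nat 1).2 hconv
    have := (h1.sub hconv).const_mul c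
    rwa [sub_self, mul_zero] at this
  obtain ⟨N, hN⟩ := (Filter.tendsto_atTop'.1 hincr) (Set.Iio (ε : ℝ)) (Iio_mem_nhds (by exact_mod_cast hε))
  set M := max (N + 1) L with hM
  have hFM : F M < ε := (hF M).trans_lt (hN M (by omega))
  have hXM : X L ≤ Y M + F M := by
    have := hXY M
    have := hE M
    have := hX (le_max_right (N + 1) L)
    linarith
  calc ENNReal.ofReal (X L) ≤ ENNReal.ofReal (Y M + ε) := ENNReal.ofReal_le_ofReal (by linarith)
    _ ≤ ENNReal.ofReal (Y M) + ENNReal.ofReal ε := ENNReal.ofReal_add_le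
    _ ≤ b + ε := by
        rw [ENNReal.ofReal_coe_nnreal]
        exact add_le_add (le_iSup (fun L => ENNReal.ofReal (Y L)) M) le_rfl

end Limit

section Exchange

variable {T : ℕ} {Θ : ℤ → ℝ} {i : ℤ}

/-- **Exchanging two adjacent columns of the strip, `θ_i ≤ θ_{i+1}`**:
`G_{Strip_T(Θ∘τ_i)}(a,b) = G_{Strip_T(Θ)}(a,b)` for boundary-type points `a, b` (vertical edges
off column `i + 1`). [cite: GlazmanManolescu2019, Proposition 4.2 (proof, §4.2)] -/
theorem twoPoint_strip_swap_adj_of_le (hΘ : ∀ k, Θ k ∈ Set.Icc (π / 3) (2 * π / 3)) (hi : 0 ≤ i) (hiT : i + 2 ≤ T)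
    (hle : Θ i ≤ Θ (i + 1)) (k j k' j' : ℤ) (hk : k ≠ i + 1) (hk' : k' ≠ i + 1) :
    twoPoint (strip T) (Θ ∘ Equiv.swap i (i + 1)) (.vert k j) (.vert k' j') = twoPoint (strip T) Θ (.vert k j) (.vert k' j') := by
  have hΘ' : ∀ k, (Θ ∘ Equiv.swap i (i + 1)) k ∈ Set.Icc (π / 3) (2 * π / 3) := fun k => hΘ _
  set X : ℕ → ℝ := fun L => (gridCx Θ).wsum (rect T L) (.vert k j) (.vert k' j') with hX
  set Y : ℕ → ℝ := fun L => (gridCx (Θ ∘ Equiv.swap i (i + 1))).wsum (rect T L) (.vert k j) (.vert k' j') with hY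
  have hXm : Monotone X := monotone_nat_of_le_succ fun L =>
    gridCx_wsum_mono hΘ (fun f hf => rect_mono_succ hf) (rect_finite T (L + 1)) (.vert k j) (.vert k' j')
  have hYm : Monotone Y := monotone_nat_of_le_succ fun L =>
    gridCx_wsum_mono hΘ' (fun f hf => rect_mono_succ hf) (rect_finite T (L + 1)) (.vert k j) (.vert k' j')
  have ha : ∀ k₀ j₀, MidEdge.vert k j = .vert k₀ j₀ → k₀ ≠ i + 1 := fun k₀ j₀ h => by
    rw [MidEdge.vert.injEq] at h; rw [← h.1]; exact hk
  choose E hE using fun L => top_end (T := T) (Θ := Θ) (i := i) hΘ hi hiT hle L (.vert k j) (.vert k' j') ha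
  choose F hF using fun L => bottom_end (T := T) (Θ := Θ) (i := i) hΘ hi hiT hle L k j k' j' hk
  have hc : 0 < weightU1 (Θ i) * weightU2 (Θ (i + 1)) := mul_pos (weightU1_pos (hΘ i)) (weightU2_pos (hΘ (i + 1)))
  set c := weightU2 (Θ (i + 1) - Θ i) / (weightU1 (Θ i) * weightU2 (Θ (i + 1))) with hcdef
  have hXY : ∀ L, X L + E L = Y L + F L := fun L => by
    rw [← (hE L).1, ← (hF L).1]; exact wsum_defCx_top_eq_bot hΘ hi hiT k j k' j' hk hk'
  have hEle : ∀ L, E L ≤ c * (X (L + 1) - X L) := fun L => by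
    rw [hcdef, div_mul_eq_mul_div, le_div_iff₀ hc]; exact (hE L).2.2
  have hFle : ∀ L, F L ≤ c * (Y (L + 1) - Y L) := fun L => by
    rw [hcdef, div_mul_eq_mul_div, le_div_iff₀ hc]; exact (hF L).2.2
  rw [twoPoint_strip_eq_iSup_rect, twoPoint_strip_eq_iSup_rect]
  simp_rw [twoPoint_eq_ofReal_wsum (rect_finite T _) hΘ, twoPoint_eq_ofReal_wsum (rect_finite T _) hΘ']
  refine le_antisymm ?_ ?_
  · exact iSup_ofReal_le_of_coupled hYm hXm (fun L => (hXY L).symm) (fun L => (hF L).2.1) hEle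
  · exact iSup_ofReal_le_of_coupled hXm hYm hXY (fun L => (hE L).2.1) hFle

/-- **Exchanging two adjacent columns of the strip** (any order of the two angles).
[cite: GlazmanManolescu2019, Proposition 4.2 (proof: "we can also assume θ₁ < θ₂")] -/
theorem twoPoint_strip_swap_adj (hΘ : ∀ k, Θ k ∈ Set.Icc (π / 3) (2 * π / 3)) (hi : 0 ≤ i) (hiT : i + 2 ≤ T)
    (k j k' j' : ℤ) (hk : k ≠ i + 1) (hk' : k' ≠ i + 1) :
    twoPoint (strip T) (Θ ∘ Equiv.swap i (i + 1)) (.vert k j) (.vert k' j') = twoPoint (strip T) Θ (.vert k j) (.vert k' j') := by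
  rcases le_or_gt (Θ i) (Θ (i + 1)) with hle | hlt
  · exact twoPoint_strip_swap_adj_of_le hΘ hi hiT hle k j k' j' hk hk'
  · have hΘ' : ∀ k, (Θ ∘ Equiv.swap i (i + 1)) k ∈ Set.Icc (π / 3) (2 * π / 3) := fun k => hΘ _
    have hle' : (Θ ∘ Equiv.swap i (i + 1)) i ≤ (Θ ∘ Equiv.swap i (i + 1)) (i + 1) := by
      simp only [Function.comp_apply, Equiv.swap_apply_left, Equiv.swap_apply_right]; exact hlt.le
    have := twoPoint_strip_swap_adj_of_le hΘ' hi hiT hle' k j k' j' hk hk'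
    rw [← this]
    congr 1
    ext x
    simp only [Function.comp_apply, Equiv.swap_apply_self]

/-- **Exchanging any two columns of the strip.** [cite: GlazmanManolescu2019, Proposition 4.2 (proof: "it suffices to prove the statement for σ a transposition of nearest neighbours")] -/
theorem twoPoint_strip_swap (hΘ : ∀ k, Θ k ∈ Set.Icc (π / 3) (2 * π / 3)) {x y : ℤ} (hx : 0 ≤ x) (hxT : x < T)
    (hy : 0 ≤ y) (hyT : y < T) (j j' : ℤ) (k k' : ℤ) (hk : k = 0 ∨ k = T) (hk' : k' = 0 ∨ k' = T) :
    twoPoint (strip T) (Θ ∘ Equiv.swap x y) (.vert k j) (.vert k' j') = twoPoint (strip T) Θ (.vert k j) (.vert k' j') := by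
  -- by induction on the distance, for `x < y`, uniformly in `Θ`
  have key : ∀ n : ℕ, ∀ x : ℤ, 0 ≤ x → x + 1 + n < T → ∀ Θ : ℤ → ℝ, (∀ k, Θ k ∈ Set.Icc (π / 3) (2 * π / 3)) →
      twoPoint (strip T) (Θ ∘ Equiv.swap x (x + 1 + n)) (.vert k j) (.vert k' j') = twoPoint (strip T) Θ (.vert k j) (.vert k' j') := by
    intro n
    induction n with
    | zero =>
      intro x hx hxT Θ hΘ
      simp only [Nat.cast_zero, add_zero]
      exact twoPoint_strip_swap_adj hΘ hx (by omega) k j k' j' (by omega) (by omega)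
    | succ n ih =>
      intro x hx hxT Θ hΘ
      have hdec : Equiv.swap x (x + 1 + (n + 1 : ℕ)) =
          Equiv.swap (x + 1) (x + 1 + (n + 1 : ℕ)) * Equiv.swap x (x + 1) * Equiv.swap (x + 1) (x + 1 + (n + 1 : ℕ)) := by
        rw [Equiv.swap_mul_swap_mul_swap (by omega) (by push_cast; omega), Equiv.swap_comm]
      have h1 : ∀ Θ : ℤ → ℝ, (∀ k, Θ k ∈ Set.Icc (π / 3) (2 * π / 3)) →
          twoPoint (strip T) (Θ ∘ Equiv.swap (x + 1) (x + 1 + (n + 1 : ℕ))) (.vert k j) (.vert k' j') =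
            twoPoint (strip T) Θ (.vert k j) (.vert k' j') := by
        intro Θ hΘ
        have := ih (x + 1) (by omega) (by push_cast at hxT ⊢; omega) Θ hΘ
        rwa [show x + 1 + 1 + (n : ℤ) = x + 1 + (n + 1 : ℕ) by push_cast; ring] at this
      have h2 : ∀ Θ : ℤ → ℝ, (∀ k, Θ k ∈ Set.Icc (π / 3) (2 * π / 3)) →
          twoPoint (strip T) (Θ ∘ Equiv.swap x (x + 1)) (.vert k j) (.vert k' j') = twoPoint (strip T) Θ (.vert k j) (.vert k' j') :=
        fun Θ hΘ => twoPoint_strip_swap_adj hΘ hx (by push_cast at hxT; omega) k j k' j' (by omega) (by omega)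
      rw [hdec, Equiv.Perm.coe_mul, Equiv.Perm.coe_mul, ← Function.comp_assoc, ← Function.comp_assoc,
        h1 _ (fun k => ?_), h2 _ (fun k => ?_), h1 _ hΘ]
      · exact hΘ _
      · exact hΘ _
  rcases lt_trichotomy x y with hxy | rfl | hxy
  · obtain ⟨n, rfl⟩ : ∃ n : ℕ, y = x + 1 + n := ⟨(y - x - 1).toNat, by omega⟩
    exact key n x hx hyT Θ hΘ
  · rw [Equiv.swap_self]; rfl
  · obtain ⟨n, rfl⟩ : ∃ n : ℕ, x = y + 1 + n := ⟨(x - y - 1).toNat, by omega⟩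
    rw [Equiv.swap_comm]
    exact key n y hy hxT Θ hΘ

/-- **Invariance under the permutations of the columns of the strip**, for boundary points given
as vertical edges of the columns `0` and `T`. [cite: GlazmanManolescu2019, Proposition 4.2] -/
theorem twoPoint_strip_perm (hΘ : ∀ k, Θ k ∈ Set.Icc (π / 3) (2 * π / 3)) (σ : Equiv.Perm ℤ)
    (hσ : ∀ k, k < 0 ∨ (T : ℤ) ≤ k → σ k = k) (j j' k k' : ℤ) (hk : k = 0 ∨ k = T) (hk' : k' = 0 ∨ k' = T) :
    twoPoint (strip T) (Θ ∘ σ) (.vert k j) (.vert k' j') = twoPoint (strip T) Θ (.vert k j) (.vert k' j') := by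
  classical
  -- `σ` is a permutation of `[0, T)`, a product of transpositions
  set p : ℤ → Prop := fun x => 0 ≤ x ∧ x < T with hp
  have hσp : ∀ x, σ x ≠ x → p x := by
    intro x hx
    by_contra h
    exact hx (hσ x (by simp only [hp, not_and_or, not_le, not_lt] at h; omega))
  have hmem : ∀ x, p (σ x) ↔ p x := by
    intro x
    by_cases h : σ x = x
    · rw [h]
    · refine ⟨fun _ => hσp x h, fun _ => ?_⟩
      by_contra h'
      have h1 : σ (σ x) = σ x := by
        by_contra h''
        exact h' (hσp _ h'')
      exact h (σ.injective h1)
  haveI : Finite {x // p x} := by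
    have : Set.Finite {x : ℤ | p x} := (Set.finite_Ico (0 : ℤ) T).subset fun x hx => ⟨hx.1, hx.2⟩
    exact this.to_subtype
  have hσeq := Equiv.Perm.ofSubtype_subtypePerm hmem hσp
  rw [← hσeq]
  -- induction on a product of transpositions, uniformly in `Θ`
  suffices H : ∀ τ : Equiv.Perm {x // p x}, ∀ Θ : ℤ → ℝ, (∀ k, Θ k ∈ Set.Icc (π / 3) (2 * π / 3)) →
      twoPoint (strip T) (Θ ∘ Equiv.Perm.ofSubtype τ) (.vert k j) (.vert k' j') = twoPoint (strip T) Θ (.vert k j) (.vert k' j') from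
    H _ Θ hΘ
  intro τ
  induction τ using Equiv.Perm.swap_induction_on with
  | one => intro Θ _; rw [map_one]; rfl
  | swap_mul f x y hxy ih =>
    intro Θ hΘ
    rw [map_mul, Equiv.Perm.ofSubtype_swap_eq, Equiv.Perm.coe_mul, ← Function.comp_assoc,
      ih (Θ ∘ ⇑(Equiv.swap (x : ℤ) (y : ℤ))) (fun k => hΘ _)]
    exact twoPoint_strip_swap hΘ x.2.1 x.2.2 y.2.1 y.2.2 j j' k k' hk hk'

/-- **Glazman–Manolescu, Proposition 4.2** (`G_{Strip_T(Θ)}(a,b)` is invariant under the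
permutations of the columns of the strip), discharging the named fact
`GlazmanManolescu2019_prop42` of `YangBaxterSAWTwoPoint.lean`. [cite: GlazmanManolescu2019, Proposition 4.2] -/
theorem GlazmanManolescu2019_prop42_holds : GlazmanManolescu2019_prop42 := by
  intro T Θ σ hΘ hσ a ha b hb
  obtain ⟨j, hj⟩ := ha
  obtain ⟨j', hj'⟩ := hb
  have key : ∀ (k k' : ℤ), (k = 0 ∨ k = T) → (k' = 0 ∨ k' = T) →
      twoPoint (strip T) (Θ ∘ σ) (.vert k j) (.vert k' j') = twoPoint (strip T) Θ (.vert k j) (.vert k' j') :=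
    fun k k' hk hk' => twoPoint_strip_perm hΘ σ hσ j j' k k' hk hk'
  rcases hj with rfl | rfl <;> rcases hj' with rfl | rfl
  · exact key 0 0 (Or.inl rfl) (Or.inl rfl)
  · exact key 0 T (Or.inl rfl) (Or.inr rfl)
  · exact key T 0 (Or.inr rfl) (Or.inl rfl)
  · exact key T T (Or.inr rfl) (Or.inr rfl)

end Exchange

end Literature.Probability.RandomPlanarGeometry.SAW.YangBaxter
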